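import Literature.MathematicalPhysics.QuantumFieldTheory.ChatterjeeFreeEnergyBounds
import HarnessLib

/-!
# Chatterjee's free-energy asymptotics: the joint limit `n → ∞`, `β → ∞` (Lemmas 17.4, 17.7, Theorem 2.1 for `U(N)`)

S. Chatterjee, *The leading term of the Yang–Mills free energy*, J. Funct. Anal. 271 (2016),
arXiv:1602.01222, §17 — the passage from the two-sided bounds in free-energy-per-site form
(`ChatterjeeFreeEnergyBounds`: `T_le_G_add`, `G_sub_le_T_small`, `G_sub_le_T_special`,
`F_le_mul_F`, `mul_F_le_F`, `F_ge_of_ge`) to the *joint* limit of Theorem 2.1 for `U(N)` lattice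
gauge theory on the cubes `B_n = {0,…,n-1}^d`, modulo the existence of the lattice Maxwell free
energy per site (Theorem 15.2), which enters as the hypothesis
`hL : log Z_M(B_n)/n^d → L`:

* `tendsto_freeEnergyPerSite_of_tendsto_logZM` (**Theorem 2.1 for `U(N)`, soft constant**): for
  `d ≥ 2`, `N ≥ 1`, jointly as `n → ∞`, `β → ∞`,
  `F(B_n, β) + ½(d - 1 - d/n + 1/n^d)N² log β → (d-1) log c_H + N² L`
  (`c_H = haarChartConst N`, evaluated in `UnitaryHaarVolume`).
* `eventually_T_le` (**Lemma 17.4**, the upper bound): for `n ≤ β^a`, `a = 1/(6(d+1))`, Lemma 17.2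
  applies directly (`rho0_le_eighth`, `errU_sq_le`: `δ_{n,β} → 0`, `βδ³_{n,β} → 0` via the majorant
  `Vf → 0`); for `n > β^a` compare with `m = min(⌊β^a⌋, ⌊n/β^{a/2}⌋)` by Lemma 17.3 (`T_le_T_add`).
* `eventually_le_T` (**Lemma 17.7**, the lower bound) in three regimes: `n ≤ β^c`, `c = 1/(10(d+2))`
  (`lowA`: the union bound `half_le_τ` supplies the Gaussian small-ball probability); `β^c < n ≤ β³`
  (`lowC`: round `n` up to the next special side length `ρ(m-1)+1`, `m = ⌊β^b⌋`, `b = 1/(40(d+2))`,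
  and use Theorem 14.3 there, `lowB`); `n > β³` (`lowD`: descend by Lemma 17.5 to
  `n'' = ⌈β²⌉(m-1)+1`, `T_sub_le_T_of_ge`, then `lowB`). The radius of Lemma 17.6 is `r = β^{-2/5}`;
  all error terms (`e0`, `errLB`, `JD`, `K₃β^{b-c} log β`, `Wfun/β^{1/5}`, `Rbfun/β^{1/10}`) tend to
  zero by elementary asymptotics of `β^p (log β)^k`.
* `tendsto_T` (both bounds), `tendsto_coef` (Lemma 17.1: `|E_n^1|/n^d → d-1`), `tendsto_G`.

Everything is proved; no named fact is introduced; all definitions are explicit auxiliary constants,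
exponents and majorants.

## References

* S. Chatterjee, *The leading term of the Yang–Mills free energy*, J. Funct. Anal. 271 (2016)
  2944–3005, arXiv:1602.01222, §17 (Lemmas 17.1–17.7, proof of Theorem 2.1). [arXiv160201222]
-/

noncomputable section

open MeasureTheory Measure ProbabilityTheory Finset Matrix WithLp Filter Topology
open scoped ENNReal NNReal Matrix.Norms.Frobenius
open Literature.Probability.LatticeModels Literature.MathematicalPhysics.QuantumLattice

namespace Literature.MathematicalPhysics.QuantumFieldTheory

namespace ChatterjeeJointLimit

open UnitaryCayley AxialGauge WilsonWeakCoupling GaussianToolkit LatticeMaxwell ChatterjeeAssembly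
  ChatterjeeFreeEnergy

variable {d N : ℕ}

/-! ## The joint limit `n → ∞`, `β → ∞` (§17: Lemmas 17.4, 17.7 and the proof of Theorem 2.1)

### Elementary helpers -/

/-- `θ x ≤ x + (1 - θ)|x|` for `θ ≤ 1`. [folklore] -/
theorem theta_mul_le {θ x : ℝ} (h1 : θ ≤ 1) : θ * x ≤ x + (1 - θ) * |x| := by
  rcases le_or_gt 0 x with hx | hx
  · rw [abs_of_nonneg hx]; nlinarith
  · rw [abs_of_neg hx]; nlinarith

/-- `x - |θ - 1| |x| ≤ θ x`. [folklore] -/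
theorem sub_abs_mul_le_theta_mul (θ x : ℝ) : x - |θ - 1| * |x| ≤ θ * x := by
  have : x - θ * x = -((θ - 1) * x) := by ring
  have h := abs_mul (θ - 1) x
  have h2 := neg_abs_le ((θ - 1) * x)
  have h3 := le_abs_self ((θ - 1) * x)
  nlinarith

/-- `|coef n - coef m| ≤ (d+1)/m` for `1 ≤ m ≤ n` (`d ≥ 1`). [cite: arXiv160201222, Lemma 17.1] -/
theorem abs_coef_sub_le (hd : 1 ≤ d) {m n : ℕ} (hm : 1 ≤ m) (hmn : m ≤ n) :
    |coef d n - coef d m| ≤ ((d : ℝ) + 1) / m := by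
  have hn : 1 ≤ n := hm.trans hmn
  rw [coef_eq hd hn, coef_eq hd hm]
  have hm0 : (0 : ℝ) < m := by exact_mod_cast hm
  have hn0 : (0 : ℝ) < n := by exact_mod_cast hn
  have hmn' : (m : ℝ) ≤ n := by exact_mod_cast hmn
  have e1 : |(d : ℝ) / m - d / n| ≤ d / m := by
    rw [abs_of_nonneg (by rw [sub_nonneg]; exact div_le_div_of_nonneg_left (Nat.cast_nonneg d) hm0 hmn')]
    have : 0 ≤ (d : ℝ) / n := by positivity
    linarith
  have e2 : |1 / (n : ℝ) ^ d - 1 / (m : ℝ) ^ d| ≤ 1 / m := by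
    have hmd : (0 : ℝ) < (m : ℝ) ^ d := by positivity
    have hnd : (0 : ℝ) < (n : ℝ) ^ d := by positivity
    have hle : 1 / (n : ℝ) ^ d ≤ 1 / (m : ℝ) ^ d :=
      div_le_div_of_nonneg_left zero_le_one hmd (pow_le_pow_left₀ hm0.le hmn' d)
    rw [abs_of_nonpos (by linarith)]
    have h1 : 1 / (m : ℝ) ^ d ≤ 1 / m := by
      apply div_le_div_of_nonneg_left zero_le_one hm0
      calc (m : ℝ) = (m : ℝ) ^ 1 := (pow_one _).symm
        _ ≤ (m : ℝ) ^ d := pow_le_pow_right₀ (by exact_mod_cast hm) hd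
    have h2 : 0 ≤ 1 / (n : ℝ) ^ d := by positivity
    linarith
  calc |(d : ℝ) - 1 - d / n + 1 / (n : ℝ) ^ d - ((d : ℝ) - 1 - d / m + 1 / (m : ℝ) ^ d)|
      = |((d : ℝ) / m - d / n) + (1 / (n : ℝ) ^ d - 1 / (m : ℝ) ^ d)| := by ring_nf
    _ ≤ |(d : ℝ) / m - d / n| + |1 / (n : ℝ) ^ d - 1 / (m : ℝ) ^ d| := abs_add_le _ _
    _ ≤ d / m + 1 / m := add_le_add e1 e2
    _ = ((d : ℝ) + 1) / m := by ring

/-- `(1 + x)^d - 1 ≤ d 2^{d-1} x` for `0 ≤ x ≤ 1`. [folklore] -/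
theorem one_add_pow_sub_one_le {x : ℝ} (hx0 : 0 ≤ x) (hx1 : x ≤ 1) (d : ℕ) :
    (1 + x) ^ d - 1 ≤ d * 2 ^ (d - 1) * x := by
  have hgeom : (1 + x) ^ d - 1 = x * ∑ i ∈ Finset.range d, (1 + x) ^ i := by
    have := geom_sum_mul (1 + x) d
    rw [add_sub_cancel_left] at this
    linarith [this]
  rw [hgeom]
  have hsum : ∑ i ∈ Finset.range d, (1 + x) ^ i ≤ d * 2 ^ (d - 1) := by
    calc ∑ i ∈ Finset.range d, (1 + x) ^ i ≤ ∑ _i ∈ Finset.range d, (2 : ℝ) ^ (d - 1) := by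
          refine Finset.sum_le_sum fun i hi => ?_
          rw [Finset.mem_range] at hi
          calc (1 + x) ^ i ≤ (2 : ℝ) ^ i := pow_le_pow_left₀ (by linarith) (by linarith) i
            _ ≤ 2 ^ (d - 1) := pow_le_pow_right₀ one_le_two (by omega)
      _ = d * 2 ^ (d - 1) := by rw [Finset.sum_const, Finset.card_range, nsmul_eq_mul]
  nlinarith

/-- `(n'/n)^d - 1 ≤ d 2^{d-1} (n' - n)/n` for `n ≤ n' ≤ 2n`. [folklore] -/
theorem div_pow_sub_one_le {n n' : ℕ} (hn : 1 ≤ n) (h1 : n ≤ n') (h2 : n' ≤ 2 * n) :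
    ((n' : ℝ) / n) ^ d - 1 ≤ d * 2 ^ (d - 1) * (((n' : ℝ) - n) / n) := by
  have hn0 : (0 : ℝ) < n := by exact_mod_cast hn
  have hx : (n' : ℝ) / n = 1 + ((n' : ℝ) - n) / n := by field_simp; ring
  rw [hx]
  refine one_add_pow_sub_one_le (div_nonneg (by rw [sub_nonneg]; exact_mod_cast h1) hn0.le) ?_ d
  rw [div_le_one hn0]
  have : (n' : ℝ) ≤ 2 * n := by exact_mod_cast h2
  linarith

/-- `log κ(r) ≤ 3r` for `0 ≤ r ≤ 1/2`. [folklore] -/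
theorem log_kappa_le {r : ℝ} (hr0 : 0 ≤ r) (hr : r ≤ 1 / 2) : Real.log (κ r) ≤ 3 * r := by
  have hκ : 0 < κ r := by unfold κ; positivity
  refine (Real.log_le_sub_one_of_pos hκ).trans ?_
  unfold κ; nlinarith

/-- `(log β)^k/β^s → 0` as `β → ∞` for `s > 0`. [folklore] -/
theorem tendsto_log_pow_div_rpow (k : ℕ) {s : ℝ} (hs : 0 < s) :
    Tendsto (fun β : ℝ => Real.log β ^ k / β ^ s) atTop (𝓝 0) := by
  have h := (isLittleO_log_rpow_rpow_atTop (k : ℝ) hs).tendsto_div_nhds_zero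
  refine h.congr' (Eventually.of_forall fun β => ?_)
  simp [Real.rpow_natCast]

/-- `log β/β^s → 0` as `β → ∞` for `s > 0`. [folklore] -/
theorem tendsto_log_div_rpow' {s : ℝ} (hs : 0 < s) :
    Tendsto (fun β : ℝ => Real.log β / β ^ s) atTop (𝓝 0) := by
  simpa using tendsto_log_pow_div_rpow 1 hs

/-- `β^a/β^b = β^(a-b)` on `(0, ∞)`, as an eventual identity at `+∞`. [folklore] -/
theorem rpow_div_rpow_eventually (a b : ℝ) :
    (fun β : ℝ => β ^ a / β ^ b) =ᶠ[atTop] fun β => β ^ (a - b) := by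
  filter_upwards [eventually_gt_atTop 0] with β hβ
  rw [Real.rpow_sub hβ]

/-- `β^p log β → 0` for `p < 0`. [folklore] -/
theorem tendsto_rpow_mul_log {p : ℝ} (hp : p < 0) :
    Tendsto (fun β : ℝ => β ^ p * Real.log β) atTop (𝓝 0) := by
  have h := tendsto_log_div_rpow' (s := -p) (by linarith)
  refine h.congr' ?_
  filter_upwards [eventually_gt_atTop 0] with β hβ
  rw [Real.rpow_neg hβ.le, div_inv_eq_mul, mul_comm]

/-- `β^p (log β)^k → 0` for `p < 0`. [folklore] -/
theorem tendsto_rpow_mul_log_pow {p : ℝ} (hp : p < 0) (k : ℕ) :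
    Tendsto (fun β : ℝ => β ^ p * Real.log β ^ k) atTop (𝓝 0) := by
  have h := tendsto_log_pow_div_rpow k (s := -p) (by linarith)
  refine h.congr' ?_
  filter_upwards [eventually_gt_atTop 0] with β hβ
  rw [Real.rpow_neg hβ.le, div_inv_eq_mul, mul_comm]


/-! ### The scales of the upper bound: `a = 1/(6(d+1))`, majorants of `ρ₀` and of the cubic error -/

variable (d) in
/-- The exponent `a = 1/(6(d+1))` of the upper-bound scale `m ≍ β^a` (any `m` growing like a small
power of `β` works in Lemma 17.4; this choice makes `δ_{m,β} → 0` and `βδ_{m,β}³ → 0`). [cite: arXiv160201222, Lemma 17.4 (proof, choice of `m`)] -/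
def aU : ℝ := 1 / (6 * ((d : ℝ) + 1))

/-- `a > 0`. [folklore] -/
theorem aU_pos : 0 < aU d := by unfold aU; positivity

/-- `a(d+1) = 1/6`. [folklore] -/
theorem aU_mul (d : ℕ) : aU d * ((d : ℝ) + 1) = 1 / 6 := by
  unfold aU; field_simp

/-- `a ≤ 1/6`. [folklore] -/
theorem aU_le : aU d ≤ 1 / 6 := by
  unfold aU
  rw [div_le_div_iff_of_pos_left one_pos (by positivity) (by norm_num)]
  have : (0 : ℝ) ≤ d := Nat.cast_nonneg d
  linarith

variable (d) in
/-- The majorant `S̄(β) = 2dβ^a(Cβ^{ad} log β + log 2)/β` of `ρ₀(m, β)²` over `m ≤ β^a`. [cite: arXiv160201222, Lemma 17.2 (`δ_{n,β}`)] -/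
def Sbar (C β : ℝ) : ℝ := 2 * d * β ^ aU d * (C * β ^ (aU d * d) * Real.log β + Real.log 2) / β

variable (d) in
/-- `V(β) = β^{2/3} S̄(β) = 2dC β^{-1/6} log β + 2d log 2 · β^{a-1/3}`, which tends to `0`. [folklore] -/
def Vf (C β : ℝ) : ℝ :=
  2 * d * C * (β ^ (-(1 / 6 : ℝ)) * Real.log β) + 2 * d * Real.log 2 * β ^ (aU d - 1 / 3)

/-- `V(β) → 0` as `β → ∞`. [folklore] -/
theorem tendsto_Vf (C : ℝ) : Tendsto (Vf d C) atTop (𝓝 0) := by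
  have h1 : Tendsto (fun β : ℝ => β ^ (-(1 / 6 : ℝ)) * Real.log β) atTop (𝓝 0) :=
    tendsto_rpow_mul_log (by norm_num)
  have h2 : Tendsto (fun β : ℝ => β ^ (aU d - 1 / 3)) atTop (𝓝 0) := by
    have : aU d - 1 / 3 = -(1 / 3 - aU d) := by ring
    rw [this]
    exact tendsto_rpow_neg_atTop (by have := aU_le (d := d); linarith)
  have := (h1.const_mul (2 * d * C)).add (h2.const_mul (2 * d * Real.log 2))
  simp only [mul_zero, add_zero] at this
  exact this

/-- `S̄(β) = β^{-2/3} V(β)` for `β > 0`. [folklore] -/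
theorem Sbar_eq {C β : ℝ} (hβ : 0 < β) : Sbar d C β = β ^ (-(2 / 3 : ℝ)) * Vf d C β := by
  unfold Sbar Vf
  have e1 : β ^ aU d * β ^ (aU d * d) / β = β ^ (-(2 / 3 : ℝ)) * β ^ (-(1 / 6 : ℝ)) := by
    rw [← Real.rpow_add hβ, ← Real.rpow_add hβ, div_eq_mul_inv, ← Real.rpow_neg_one, ← Real.rpow_add hβ]
    congr 1
    have := aU_mul d
    linarith
  have e2 : β ^ aU d / β = β ^ (-(2 / 3 : ℝ)) * β ^ (aU d - 1 / 3) := by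
    rw [← Real.rpow_add hβ, div_eq_mul_inv, ← Real.rpow_neg_one, ← Real.rpow_add hβ]
    congr 1; ring
  calc 2 * d * β ^ aU d * (C * β ^ (aU d * d) * Real.log β + Real.log 2) / β
      = 2 * d * C * Real.log β * (β ^ aU d * β ^ (aU d * d) / β) + 2 * d * Real.log 2 * (β ^ aU d / β) := by ring
    _ = _ := by rw [e1, e2]; ring

/-- `ρ₀(m, β)² ≤ S̄(β)` for `1 ≤ m ≤ β^a`, `β ≥ 1`, `C > 0`. [cite: arXiv160201222, Lemma 17.2] -/
theorem rho0_sq_le {C β : ℝ} (hC : 0 < C) (hβ : 1 ≤ β) {m : ℕ} (hm : (m : ℝ) ≤ β ^ aU d) :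
    rho0 C d m β ^ 2 ≤ Sbar d C β := by
  have hβ0 : 0 < β := by linarith
  have hlog : 0 ≤ Real.log β := Real.log_nonneg hβ
  have hm0 : (0 : ℝ) ≤ m := Nat.cast_nonneg m
  have hmd : (m : ℝ) ^ d ≤ β ^ (aU d * d) := by
    rw [Real.rpow_mul hβ0.le, Real.rpow_natCast]
    exact pow_le_pow_left₀ hm0 hm d
  have hnum : 2 * d * m * (C * (m : ℝ) ^ d * Real.log β + Real.log 2) ≤
      2 * d * β ^ aU d * (C * β ^ (aU d * d) * Real.log β + Real.log 2) := by
    have hlog2 : 0 ≤ Real.log 2 := Real.log_nonneg one_le_two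
    have h1 : C * (m : ℝ) ^ d * Real.log β + Real.log 2 ≤ C * β ^ (aU d * d) * Real.log β + Real.log 2 := by
      nlinarith [mul_nonneg hC.le hlog]
    have h2 : 0 ≤ C * (m : ℝ) ^ d * Real.log β + Real.log 2 := by positivity
    have hd0 : (0 : ℝ) ≤ 2 * d := by positivity
    calc 2 * d * m * (C * (m : ℝ) ^ d * Real.log β + Real.log 2)
        ≤ 2 * d * β ^ aU d * (C * (m : ℝ) ^ d * Real.log β + Real.log 2) := by gcongr
      _ ≤ 2 * d * β ^ aU d * (C * β ^ (aU d * d) * Real.log β + Real.log 2) := by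
          gcongr
  rw [rho0, Real.sq_sqrt (by positivity), Sbar]
  exact div_le_div_of_nonneg_right hnum hβ0.le

/-- `ρ₀ ≤ 1/8` once `V(β) ≤ 1/64` (for `1 ≤ m ≤ β^a`, `β ≥ 1`). [cite: arXiv160201222, Lemma 17.2] -/
theorem rho0_le_eighth {C β : ℝ} (hC : 0 < C) (hβ : 1 ≤ β) {m : ℕ} (hm : (m : ℝ) ≤ β ^ aU d)
    (hV : Vf d C β ≤ 1 / 64) : rho0 C d m β ≤ 1 / 8 := by
  have hβ0 : 0 < β := by linarith
  have h1 := rho0_sq_le (d := d) hC hβ hm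
  rw [Sbar_eq hβ0] at h1
  have hb : β ^ (-(2 / 3 : ℝ)) ≤ 1 := Real.rpow_le_one_of_one_le_of_nonpos hβ (by norm_num)
  have hb0 : 0 ≤ β ^ (-(2 / 3 : ℝ)) := Real.rpow_nonneg hβ0.le _
  have hprod : β ^ (-(2 / 3 : ℝ)) * Vf d C β ≤ 1 / 64 := by
    rcases le_or_gt 0 (Vf d C β) with hV0 | hV0
    · calc β ^ (-(2 / 3 : ℝ)) * Vf d C β ≤ 1 * (1 / 64) := by gcongr
        _ = 1 / 64 := one_mul _
    · have : β ^ (-(2 / 3 : ℝ)) * Vf d C β ≤ 0 := mul_nonpos_of_nonneg_of_nonpos hb0 hV0.le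
      linarith
  have h2 : rho0 C d m β ^ 2 ≤ (1 / 8) ^ 2 := by
    calc rho0 C d m β ^ 2 ≤ β ^ (-(2 / 3 : ℝ)) * Vf d C β := h1
      _ ≤ 1 / 64 := hprod
      _ = (1 / 8) ^ 2 := by norm_num
  exact (pow_le_pow_iff_left₀ (rho0_nonneg C d m β) (by norm_num) two_ne_zero).1 h2

/-- **The cubic error of Lemma 17.2 is small**: `(67βN(2ρ₀)³d²)² ≤ 67²·64·N²d⁴·V(β)³` for
`1 ≤ m ≤ β^a`, `β ≥ 1`. [cite: arXiv160201222, Lemma 17.4 (proof, `βδ³ → 0`)] -/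
theorem errU_sq_le {C β : ℝ} (hC : 0 < C) (hβ : 1 ≤ β) {m : ℕ} (hm : (m : ℝ) ≤ β ^ aU d) :
    (67 * β * N * (2 * rho0 C d m β) ^ 3 * ((d : ℝ) * d)) ^ 2 ≤
      67 ^ 2 * 64 * (N : ℝ) ^ 2 * (d : ℝ) ^ 4 * (max (Vf d C β) 0) ^ 3 := by
  have hβ0 : 0 < β := by linarith
  have h1 := rho0_sq_le (d := d) hC hβ hm
  rw [Sbar_eq hβ0] at h1
  set V := Vf d C β with hV
  set ρ := rho0 C d m β with hρ
  have hρ0 : 0 ≤ ρ := rho0_nonneg C d m β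
  have hb0 : 0 ≤ β ^ (-(2 / 3 : ℝ)) := Real.rpow_nonneg hβ0.le _
  have h2 : ρ ^ 2 ≤ β ^ (-(2 / 3 : ℝ)) * max V 0 :=
    h1.trans (mul_le_mul_of_nonneg_left (le_max_left _ _) hb0)
  have hM0 : 0 ≤ max V 0 := le_max_right _ _
  -- cube both sides: `ρ⁶ ≤ β⁻² (max V 0)³`
  have h3 : (ρ ^ 2) ^ 3 ≤ (β ^ (-(2 / 3 : ℝ)) * max V 0) ^ 3 := pow_le_pow_left₀ (sq_nonneg _) h2 3
  have hβpow : (β ^ (-(2 / 3 : ℝ))) ^ 3 = (β ^ 2)⁻¹ := by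
    rw [← Real.rpow_natCast, ← Real.rpow_mul hβ0.le]; norm_num
    rfl
  rw [mul_pow, hβpow] at h3
  have hβ2 : 0 < β ^ 2 := by positivity
  -- the claim
  have key : β ^ 2 * ρ ^ 6 ≤ (max V 0) ^ 3 := by
    rw [show ρ ^ 6 = (ρ ^ 2) ^ 3 by ring]
    calc β ^ 2 * (ρ ^ 2) ^ 3 ≤ β ^ 2 * ((β ^ 2)⁻¹ * max V 0 ^ 3) := by gcongr
      _ = (max V 0) ^ 3 := by field_simp
  have hN0 : (0 : ℝ) ≤ (N : ℝ) ^ 2 := by positivity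
  have hd0 : (0 : ℝ) ≤ (d : ℝ) ^ 4 := by positivity
  calc (67 * β * N * (2 * ρ) ^ 3 * ((d : ℝ) * d)) ^ 2
      = 67 ^ 2 * 64 * (N : ℝ) ^ 2 * (d : ℝ) ^ 4 * (β ^ 2 * ρ ^ 6) := by ring
    _ ≤ 67 ^ 2 * 64 * (N : ℝ) ^ 2 * (d : ℝ) ^ 4 * (max V 0) ^ 3 := by gcongr


/-! ### Lemma 17.4: the upper bound for the joint limit -/

variable (d N) in
/-- The constant `K = C₇₁ + dN²/2` with `|T(B_n, β)| ≤ K log β`. [folklore] -/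
def Kc : ℝ := C71 d N + d * (N : ℝ) ^ 2 / 2

variable (d N) in
/-- The constant `K₂ = 2dK + (d + 1 + 2d²)N²/2` of the junk terms of Lemma 17.4. [folklore] -/
def K₂ : ℝ := 2 * d * Kc d N + ((d : ℝ) + 1 + 2 * (d : ℝ) ^ 2) * (N : ℝ) ^ 2 / 2

/-- `K ≥ 0`. [folklore] -/
theorem Kc_nonneg : 0 ≤ Kc d N := by
  unfold Kc; have := (C71_spec d N).1; positivity

/-- `K₂ ≥ 0`. [folklore] -/
theorem K₂_nonneg : 0 ≤ K₂ d N := by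
  unfold K₂; have := Kc_nonneg (d := d) (N := N); positivity

/-- **Lemma 17.3 ⇒ comparison of the normalised free energies**: for `β ≥ 2`, `1 ≤ m < n` and
`w ≥ max(m/n, 1/m)`, `T(B_n, β) ≤ T(B_m, β) + K₂ w log β`. [cite: arXiv160201222, Lemma 17.4 (proof)] -/
theorem T_le_T_add (hd : 1 ≤ d) {β : ℝ} (hβ2 : 2 ≤ β) {m n : ℕ} (hm1 : 1 ≤ m) (hmn : m + 1 ≤ n)
    {w : ℝ} (hmn_w : (m : ℝ) / n ≤ w) (hm_w : 1 / (m : ℝ) ≤ w) :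
    T d N n β ≤ T d N m β + K₂ d N * (w * Real.log β) := by
  have hβ0 : 0 < β := by linarith
  have hL0 : 0 ≤ Real.log β := Real.log_nonneg (by linarith)
  have hmn' : m ≤ n := by omega
  have hm0 : (0 : ℝ) < m := by exact_mod_cast hm1
  have hw0 : 0 ≤ w := le_trans (by positivity) hm_w
  have hF := F_le_mul_F (d := d) (N := N) hβ0.le hm1 hmn
  set θ : ℝ := ((((n / (m + 1) : ℕ)) : ℝ) * m / n) ^ d with hθ
  obtain ⟨hθ0', hθ1'⟩ := theta_mem (m := m) (n := n) hmn
  have hθ0 : 0 ≤ θ := pow_nonneg hθ0' d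
  have hθ1 : θ ≤ 1 := pow_le_one₀ hθ0' hθ1'
  have h1θ := one_sub_theta_pow_le (d := d) (m := m) (n := n) hmn
  have hθT := theta_mul_le (x := T d N m β) hθ1
  have habsT := abs_T_le (d := d) (N := N) hβ2 m
  have hcoef := abs_coef_sub_le (d := d) hd hm1 hmn'
  have hcoefm := coef_le (d := d) m
  have hcm0 := coef_nonneg (d := d) m
  have hw2 : 1 / ((m : ℝ) + 1) ≤ w :=
    le_trans (div_le_div_of_nonneg_left zero_le_one hm0 (by linarith)) hm_w
  have h1θ' : 1 - θ ≤ 2 * d * w := by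
    calc 1 - θ ≤ d * ((m : ℝ) / n + 1 / ((m : ℝ) + 1)) := h1θ
      _ ≤ d * (w + w) := by gcongr
      _ = 2 * d * w := by ring
  have hcoef' : coef d n - θ * coef d m ≤ ((d : ℝ) + 1) * w + 2 * (d : ℝ) ^ 2 * w := by
    have e1 : coef d n - coef d m ≤ ((d : ℝ) + 1) * w := by
      calc coef d n - coef d m ≤ |coef d n - coef d m| := le_abs_self _
        _ ≤ ((d : ℝ) + 1) / m := hcoef
        _ = ((d : ℝ) + 1) * (1 / m) := by ring
        _ ≤ ((d : ℝ) + 1) * w := by gcongr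
    have e2 : (1 - θ) * coef d m ≤ 2 * d * w * d := by
      calc (1 - θ) * coef d m ≤ (2 * d * w) * coef d m := by gcongr
        _ ≤ (2 * d * w) * d := by gcongr
    nlinarith
  have hKT : |T d N m β| ≤ Kc d N * Real.log β := by unfold Kc; exact habsT
  have hN2 : (0 : ℝ) ≤ (N : ℝ) ^ 2 := by positivity
  -- `T n ≤ θ T m + (coef n - θ coef m)/2 N² log β`
  have hTn : T d N n β ≤ θ * T d N m β + (coef d n - θ * coef d m) / 2 * (N : ℝ) ^ 2 * Real.log β := by
    have e : T d N n β = F d N n β + coef d n / 2 * (N : ℝ) ^ 2 * Real.log β := rfl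
    have e' : T d N m β = F d N m β + coef d m / 2 * (N : ℝ) ^ 2 * Real.log β := rfl
    rw [e, e']
    linarith
  have p1 : (1 - θ) * |T d N m β| ≤ (2 * d * w) * (Kc d N * Real.log β) :=
    mul_le_mul h1θ' hKT (abs_nonneg _) (by positivity)
  have p2 : (coef d n - θ * coef d m) / 2 * (N : ℝ) ^ 2 * Real.log β ≤
      (((d : ℝ) + 1) * w + 2 * (d : ℝ) ^ 2 * w) / 2 * (N : ℝ) ^ 2 * Real.log β := by
    gcongr
  have hK2 : K₂ d N * (w * Real.log β) =
      (2 * d * w) * (Kc d N * Real.log β) + (((d : ℝ) + 1) * w + 2 * (d : ℝ) ^ 2 * w) / 2 * (N : ℝ) ^ 2 * Real.log β := by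
    unfold K₂; ring
  rw [hK2]
  linarith

/-- **Lemma 17.4 (the upper bound, joint in `n` and `β`)**: if `G(n) → A` then for every `ε > 0`,
eventually as `(n, β) → (∞, ∞)`, `T(B_n, β) ≤ A + ε`. Proof as printed: for `n ≤ β^a` Lemma 17.2
applies directly (`δ_{n,β}, βδ³_{n,β} → 0`); otherwise compare with `F(B_m, β)` by Lemma 17.3 for
`m = min(⌊β^a⌋, ⌊n/β^{a/2}⌋)`, so that `m → ∞`, `(m/n) log β → 0` and `(log β)/m → 0`. [cite: arXiv160201222, Lemma 17.4] -/
theorem eventually_T_le (hd : 2 ≤ d) {A : ℝ} (hG : Tendsto (G d N) atTop (𝓝 A))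
    {ε : ℝ} (hε : 0 < ε) :
    ∀ᶠ p : ℕ × ℝ in atTop ×ˢ atTop, T d N p.1 p.2 ≤ A + ε := by
  have hd1 : 1 ≤ d := by omega
  set C := C71 d N with hC
  have hC0 : 0 < C := (C71_spec d N).1
  set a := aU d with ha
  have ha0 : 0 < a := aU_pos
  -- Step 1: threshold in `m` from `G → A` and `log 2/m^d → 0`
  have hev_m : ∀ᶠ m : ℕ in atTop, G d N m ≤ A + ε / 4 ∧ Real.log 2 / (m : ℝ) ^ d ≤ ε / 4 := by
    have h1 : ∀ᶠ m : ℕ in atTop, G d N m ≤ A + ε / 4 :=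
      (hG.eventually (ge_mem_nhds (by linarith : A < A + ε / 4)))
    have h2 : Tendsto (fun m : ℕ => Real.log 2 / (m : ℝ) ^ d) atTop (𝓝 0) :=
      tendsto_const_nhds.div_atTop ((tendsto_pow_atTop (by omega)).comp tendsto_natCast_atTop_atTop)
    exact h1.and (h2.eventually (ge_mem_nhds (by positivity)))
  obtain ⟨M₀, hM₀⟩ := eventually_atTop.1 hev_m
  set M := max M₀ 1 with hM
  have hMspec : ∀ m, M ≤ m → G d N m ≤ A + ε / 4 ∧ Real.log 2 / (m : ℝ) ^ d ≤ ε / 4 :=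
    fun m hm => hM₀ m ((le_max_left _ _).trans hm)
  have hM1 : 1 ≤ M := le_max_right _ _
  -- Step 2: thresholds in `β`
  have hV3 : Tendsto (fun β => 67 ^ 2 * 64 * (N : ℝ) ^ 2 * (d : ℝ) ^ 4 * (max (Vf d C β) 0) ^ 3)
      atTop (𝓝 0) := by
    have h := ((tendsto_Vf (d := d) C).max (tendsto_const_nhds (x := (0 : ℝ)))).pow 3
    simpa using h.const_mul (67 ^ 2 * 64 * (N : ℝ) ^ 2 * (d : ℝ) ^ 4)
  have hJ : Tendsto (fun β => K₂ d N * (2 * Real.log β / β ^ (a / 2))) atTop (𝓝 0) := by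
    have h := ((tendsto_log_div_rpow' (s := a / 2) (by positivity)).const_mul 2).const_mul (K₂ d N)
    simpa [mul_div_assoc] using h
  have hev_β : ∀ᶠ β : ℝ in atTop, 2 ≤ β ∧ Vf d C β ≤ 1 / 64 ∧
      67 ^ 2 * 64 * (N : ℝ) ^ 2 * (d : ℝ) ^ 4 * (max (Vf d C β) 0) ^ 3 ≤ (ε / 4) ^ 2 ∧
      (M : ℝ) + 2 ≤ β ^ (a / 2) ∧ K₂ d N * (2 * Real.log β / β ^ (a / 2)) ≤ ε / 4 :=
    (eventually_ge_atTop 2).and (((tendsto_Vf (d := d) C).eventually (ge_mem_nhds (by norm_num))).and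
      ((hV3.eventually (ge_mem_nhds (by positivity))).and
      (((tendsto_rpow_atTop (by positivity)).eventually_ge_atTop _).and
      (hJ.eventually (ge_mem_nhds (by positivity))))))
  -- Step 3: the pointwise argument
  refine ((eventually_ge_atTop M).prod_mk hev_β).mono ?_
  rintro ⟨n, β⟩ ⟨hn, hβ2, hV, hE, hscale, hjunk⟩
  dsimp only at hn hβ2 hV hE hscale hjunk ⊢
  have hβ1 : 1 ≤ β := by linarith
  have hβ0 : 0 < β := by linarith
  have hL0 : 0 ≤ Real.log β := Real.log_nonneg hβ1
  -- Case A as a reusable claim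
  have caseA : ∀ m : ℕ, M ≤ m → (m : ℝ) ≤ β ^ a → T d N m β ≤ A + 3 * ε / 4 := by
    intro m hMm hma
    have hm1 : 1 ≤ m := hM1.trans hMm
    have hρ := rho0_le_eighth (d := d) hC0 hβ1 hma hV
    have h := T_le_G_add (d := d) (N := N) hβ2 hm1 hρ
    have hE0 : 0 ≤ 67 * β * N * (2 * rho0 C d m β) ^ 3 * ((d : ℝ) * d) := by
      have := rho0_nonneg C d m β; positivity
    have hEsq := (errU_sq_le (d := d) (N := N) hC0 hβ1 hma).trans hE
    have hEle := (pow_le_pow_iff_left₀ hE0 (by positivity) two_ne_zero).1 hEsq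
    obtain ⟨hGm, hlogm⟩ := hMspec m hMm
    linarith
  by_cases hcase : (n : ℝ) ≤ β ^ a
  · linarith [caseA n hn hcase]
  · push Not at hcase
    -- the scales `u = β^{a/2}`, `m = min(⌊β^a⌋, ⌊n/u⌋)`
    have hu3 : (3 : ℝ) ≤ β ^ (a / 2) := by
      have : (1 : ℝ) ≤ M := by exact_mod_cast hM1
      linarith
    generalize hu : β ^ (a / 2) = u at hu3 hscale hjunk
    have hu0 : 0 < u := by linarith
    have hu2 : u ^ 2 = β ^ a := by
      rw [← hu, ← Real.rpow_natCast, ← Real.rpow_mul hβ0.le]; congr 1; push_cast; ring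
    have hβa0 : 0 ≤ β ^ a := Real.rpow_nonneg hβ0.le a
    have hn1 : 1 ≤ n := hM1.trans hn
    have hn0 : (0 : ℝ) < n := by exact_mod_cast hn1
    obtain ⟨m, f1, f2, f3⟩ : ∃ m : ℕ, (m : ℝ) ≤ β ^ a ∧ (m : ℝ) ≤ n / u ∧ u - 1 < m := by
      refine ⟨min ⌊β ^ a⌋₊ ⌊(n : ℝ) / u⌋₊, ?_, ?_, ?_⟩
      · exact le_trans (by exact_mod_cast min_le_left _ _) (Nat.floor_le hβa0)
      · exact le_trans (by exact_mod_cast min_le_right _ _) (Nat.floor_le (by positivity))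
      · have h1 : β ^ a - 1 < ⌊β ^ a⌋₊ := by linarith [Nat.lt_floor_add_one (β ^ a)]
        have h2 : (n : ℝ) / u - 1 < ⌊(n : ℝ) / u⌋₊ := by linarith [Nat.lt_floor_add_one ((n : ℝ) / u)]
        have hua : u ≤ β ^ a := by rw [← hu2]; nlinarith
        have hnu : u < n / u := by rw [lt_div_iff₀ hu0]; nlinarith
        rcases Nat.le_total ⌊β ^ a⌋₊ ⌊(n : ℝ) / u⌋₊ with hle | hle
        · rw [min_eq_left hle]; linarith
        · rw [min_eq_right hle]; linarith
    have hMm : M ≤ m := by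
      have : (M : ℝ) < m := by linarith
      exact_mod_cast this.le
    have hm1 : 1 ≤ m := hM1.trans hMm
    have hm0 : (0 : ℝ) < m := by exact_mod_cast hm1
    have hmn : m + 1 ≤ n := by
      have : (m : ℝ) < n := by
        calc (m : ℝ) ≤ n / u := f2
          _ < n := by rw [div_lt_iff₀ hu0]; nlinarith
      exact_mod_cast this
    -- `w = 1/(u-1)`
    have hw1 : (m : ℝ) / n ≤ 1 / (u - 1) := by
      rw [div_le_div_iff₀ hn0 (by linarith)]
      rw [le_div_iff₀ hu0] at f2
      nlinarith
    have hw3 : 1 / (m : ℝ) ≤ 1 / (u - 1) :=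
      div_le_div_of_nonneg_left zero_le_one (by linarith) (by linarith)
    have hcmp := T_le_T_add (d := d) (N := N) hd1 hβ2 hm1 hmn hw1 hw3
    have hTm := caseA m hMm f1
    -- junk ≤ K₂ (2 log β / u) ≤ ε/4
    have hjunk' : K₂ d N * (1 / (u - 1) * Real.log β) ≤ ε / 4 := by
      have hw4 : 1 / (u - 1) ≤ 2 / u := by
        rw [div_le_div_iff₀ (by linarith) hu0]; linarith
      have : 1 / (u - 1) * Real.log β ≤ 2 * Real.log β / u := by
        calc 1 / (u - 1) * Real.log β ≤ (2 / u) * Real.log β := by gcongr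
          _ = 2 * Real.log β / u := by ring
      exact le_trans (mul_le_mul_of_nonneg_left this K₂_nonneg) hjunk
    linarith


/-! ### Lemma 17.7: comparison lemmas for the lower bound -/

/-- `coef n' - coef n ≤ d (n' - n)/n` for `1 ≤ n ≤ n'`. [cite: arXiv160201222, Lemma 17.1] -/
theorem coef_sub_coef_le (hd : 1 ≤ d) {n n' : ℕ} (hn : 1 ≤ n) (h : n ≤ n') :
    coef d n' - coef d n ≤ d * (((n' : ℝ) - n) / n) := by
  have hn' : 1 ≤ n' := hn.trans h
  rw [coef_eq hd hn, coef_eq hd hn']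
  have hn0 : (0 : ℝ) < n := by exact_mod_cast hn
  have hn'0 : (0 : ℝ) < n' := by exact_mod_cast hn'
  have hnn' : (n : ℝ) ≤ n' := by exact_mod_cast h
  have e1 : (d : ℝ) / n - d / n' ≤ d * (((n' : ℝ) - n) / n) := by
    have hd0 : (0 : ℝ) ≤ d := Nat.cast_nonneg d
    have lhs : (d : ℝ) / n - d / n' = d * (((n' : ℝ) - n) / n) * (1 / n') := by
      field_simp
    rw [lhs]
    have h1 : 1 / (n' : ℝ) ≤ 1 := by rw [div_le_one hn'0]; exact_mod_cast hn'
    have h0 : 0 ≤ d * (((n' : ℝ) - n) / n) := by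
      have := sub_nonneg.2 hnn'; positivity
    calc d * (((n' : ℝ) - n) / n) * (1 / n') ≤ d * (((n' : ℝ) - n) / n) * 1 := by gcongr
      _ = d * (((n' : ℝ) - n) / n) := mul_one _
  have e2 : 1 / (n' : ℝ) ^ d ≤ 1 / (n : ℝ) ^ d :=
    div_le_div_of_nonneg_left zero_le_one (by positivity) (pow_le_pow_left₀ hn0.le hnn' d)
  linarith

variable (d N) in
/-- The constant `K₃ = d2^{d-1}K + (d²2^{d-1} + d)N²/2` of the rounding-up comparison. [folklore] -/
def K₃ : ℝ := d * 2 ^ (d - 1) * Kc d N + ((d : ℝ) ^ 2 * 2 ^ (d - 1) + d) * (N : ℝ) ^ 2 / 2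

/-- `K₃ ≥ 0`. [folklore] -/
theorem K₃_nonneg : 0 ≤ K₃ d N := by
  unfold K₃; have := Kc_nonneg (d := d) (N := N); positivity

/-- **Rounding the side length up** (monotonicity of `Z` in the cube): for `β ≥ 2`, `1 ≤ n ≤ n' ≤ 2n`,
`T(B_n, β) ≥ T(B_{n'}, β) - K₃ ((n'-n)/n) log β`. [cite: arXiv160201222, Lemma 17.7 (proof)] -/
theorem T_sub_le_T_of_le (hd : 1 ≤ d) {β : ℝ} (hβ2 : 2 ≤ β) {n n' : ℕ} (hn : 1 ≤ n) (h1 : n ≤ n')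
    (h2 : n' ≤ 2 * n) :
    T d N n' β - K₃ d N * (((n' : ℝ) - n) / n) * Real.log β ≤ T d N n β := by
  have hβ0 : 0 < β := by linarith
  have hL0 : 0 ≤ Real.log β := Real.log_nonneg (by linarith)
  have hn0 : (0 : ℝ) < n := by exact_mod_cast hn
  set x : ℝ := ((n' : ℝ) - n) / n with hx
  have hx0 : 0 ≤ x := by rw [hx]; exact div_nonneg (sub_nonneg.2 (by exact_mod_cast h1)) hn0.le
  set φ : ℝ := ((n' : ℝ) / n) ^ d with hφ
  have hφF := mul_F_le_F (d := d) (N := N) hβ0.le hn h1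
  have hφ1 : 1 ≤ φ := one_le_pow₀ (by rw [le_div_iff₀ hn0, one_mul]; exact_mod_cast h1)
  have hφsub : φ - 1 ≤ d * 2 ^ (d - 1) * x := div_pow_sub_one_le (d := d) hn h1 h2
  have habsT := abs_T_le (d := d) (N := N) hβ2 n'
  have hKT : |T d N n' β| ≤ Kc d N * Real.log β := by unfold Kc; exact habsT
  have hθT := sub_abs_mul_le_theta_mul φ (T d N n' β)
  rw [abs_of_nonneg (by linarith : 0 ≤ φ - 1)] at hθT
  have hcs := coef_sub_coef_le (d := d) hd hn h1
  have hcn' := coef_le (d := d) n'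
  have hcn'0 := coef_nonneg (d := d) n'
  have hN2 : (0 : ℝ) ≤ (N : ℝ) ^ 2 := by positivity
  -- `T n ≥ φ T n' - (φ coef n' - coef n)/2 N² L`
  have hTn : φ * T d N n' β - (φ * coef d n' - coef d n) / 2 * (N : ℝ) ^ 2 * Real.log β ≤ T d N n β := by
    have e : T d N n β = F d N n β + coef d n / 2 * (N : ℝ) ^ 2 * Real.log β := rfl
    have e' : T d N n' β = F d N n' β + coef d n' / 2 * (N : ℝ) ^ 2 * Real.log β := rfl
    rw [e, e']; linarith
  have p1 : (φ - 1) * |T d N n' β| ≤ (d * 2 ^ (d - 1) * x) * (Kc d N * Real.log β) :=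
    mul_le_mul hφsub hKT (abs_nonneg _) (by positivity)
  have hc2 : φ * coef d n' - coef d n ≤ (d * 2 ^ (d - 1) * x) * d + d * x := by
    have e1 : (φ - 1) * coef d n' ≤ (d * 2 ^ (d - 1) * x) * d := by
      calc (φ - 1) * coef d n' ≤ (d * 2 ^ (d - 1) * x) * coef d n' := by gcongr
        _ ≤ (d * 2 ^ (d - 1) * x) * d := by gcongr
    nlinarith
  have p2 : (φ * coef d n' - coef d n) / 2 * (N : ℝ) ^ 2 * Real.log β ≤
      ((d * 2 ^ (d - 1) * x) * d + d * x) / 2 * (N : ℝ) ^ 2 * Real.log β := by gcongr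
  have hK3 : K₃ d N * x * Real.log β =
      (d * 2 ^ (d - 1) * x) * (Kc d N * Real.log β) + ((d * 2 ^ (d - 1) * x) * d + d * x) / 2 * (N : ℝ) ^ 2 * Real.log β := by
    unfold K₃; ring
  rw [hK3]
  linarith

/-- `#planes ≤ d²`. [folklore] -/
theorem card_planes_le : (Fintype.card {q : Fin d × Fin d // q.1 < q.2} : ℝ) ≤ (d : ℝ) ^ 2 := by
  have h := Fintype.card_subtype_le (fun q : Fin d × Fin d => q.1 < q.2)
  rw [Fintype.card_prod, Fintype.card_fin] at h
  have : ((Fintype.card {q : Fin d × Fin d // q.1 < q.2} : ℕ) : ℝ) ≤ ((d * d : ℕ) : ℝ) := by exact_mod_cast h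
  simpa [sq] using this

/-- `s^d - (s-1)^d ≤ d s^{d-1}` for `s ≥ 1`. [folklore] -/
theorem pow_sub_pow_le {s : ℝ} (hs : 1 ≤ s) (d : ℕ) : s ^ d - (s - 1) ^ d ≤ d * s ^ (d - 1) := by
  rcases Nat.eq_zero_or_pos d with rfl | hd
  · simp
  have hs0 : 0 < s := by linarith
  have hb : (-2 : ℝ) ≤ -(1 / s) := by
    have : 1 / s ≤ 1 := by rw [div_le_one hs0]; exact hs
    linarith
  have h1 := one_add_mul_le_pow hb d
  have hsd : 0 < s ^ d := by positivity
  have e1 : (1 + -(1 / s)) ^ d * s ^ d = (s - 1) ^ d := by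
    rw [← mul_pow]; congr 1; field_simp; ring
  have hsplit : s ^ d = s * s ^ (d - 1) := by rw [← pow_succ']; congr 1; omega
  have e2 : (1 + (d : ℝ) * -(1 / s)) * s ^ d = s ^ d - d * s ^ (d - 1) := by
    rw [hsplit]; field_simp; ring
  have h2 := mul_le_mul_of_nonneg_right h1 hsd.le
  rw [e1, e2] at h2
  linarith

/-- The junk term of `F_ge_of_ge` is `O(β/n'')`: with `s = n''+1 ≤ n` and `k s ≤ n + s`,
`2NβD(k/n)^d(2n''^{d-1} + s^d - n''^d) ≤ 2^{d+1}(d+2)Nd²β/s`. [cite: arXiv160201222, Lemma 17.5] -/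
theorem junk_le (hd : 1 ≤ d) {β : ℝ} (hβ : 0 ≤ β) {n'' n k : ℕ} (hn'' : 1 ≤ n'') (hn : n'' + 1 ≤ n)
    (hks2 : (k : ℝ) * ((n'' : ℝ) + 1) ≤ n + ((n'' : ℝ) + 1)) :
    2 * N * β * Fintype.card {q : Fin d × Fin d // q.1 < q.2} * ((k : ℝ) / n) ^ d *
        (2 * (n'' : ℝ) ^ (d - 1) + (((n'' : ℝ) + 1) ^ d - (n'' : ℝ) ^ d)) ≤
      2 ^ (d + 1) * ((d : ℝ) + 2) * N * (d : ℝ) ^ 2 * β / ((n'' : ℝ) + 1) := by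
  set D : ℝ := (Fintype.card {q : Fin d × Fin d // q.1 < q.2} : ℝ) with hD
  have hDle : D ≤ (d : ℝ) ^ 2 := card_planes_le
  have hn1 : 1 ≤ n := le_trans (by omega) hn
  have hn0 : (0 : ℝ) < n := by exact_mod_cast hn1
  have hs0 : (0 : ℝ) < (n'' : ℝ) + 1 := by positivity
  have hn''0 : (0 : ℝ) < n'' := by exact_mod_cast hn''
  have hsn : (n'' : ℝ) + 1 ≤ n := by exact_mod_cast hn
  have hk0 : (0 : ℝ) ≤ k := Nat.cast_nonneg k
  have hkn : (k : ℝ) / n ≤ 2 / ((n'' : ℝ) + 1) := by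
    rw [div_le_div_iff₀ hn0 hs0]; nlinarith
  have hkn0 : 0 ≤ (k : ℝ) / n := by positivity
  have hpow1 : ((k : ℝ) / n) ^ d ≤ (2 / ((n'' : ℝ) + 1)) ^ d := pow_le_pow_left₀ hkn0 hkn d
  have hs1 : (n'' : ℝ) ^ (d - 1) ≤ ((n'' : ℝ) + 1) ^ (d - 1) := pow_le_pow_left₀ hn''0.le (by linarith) _
  have hdiff : ((n'' : ℝ) + 1) ^ d - (n'' : ℝ) ^ d ≤ d * ((n'' : ℝ) + 1) ^ (d - 1) := by
    have := pow_sub_pow_le (s := (n'' : ℝ) + 1) (by linarith) d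
    rwa [add_sub_cancel_right] at this
  have hsum : 2 * (n'' : ℝ) ^ (d - 1) + (((n'' : ℝ) + 1) ^ d - (n'' : ℝ) ^ d) ≤
      ((d : ℝ) + 2) * ((n'' : ℝ) + 1) ^ (d - 1) := by nlinarith
  have hsum0 : 0 ≤ 2 * (n'' : ℝ) ^ (d - 1) + (((n'' : ℝ) + 1) ^ d - (n'' : ℝ) ^ d) := by
    have : (n'' : ℝ) ^ d ≤ ((n'' : ℝ) + 1) ^ d := pow_le_pow_left₀ hn''0.le (by linarith) d
    have : 0 ≤ (n'' : ℝ) ^ (d - 1) := by positivity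
    linarith
  have hsplit : ((n'' : ℝ) + 1) ^ d = ((n'' : ℝ) + 1) * ((n'' : ℝ) + 1) ^ (d - 1) := by
    rw [← pow_succ']; congr 1; omega
  have hpow2 : (2 / ((n'' : ℝ) + 1)) ^ d * ((n'' : ℝ) + 1) ^ (d - 1) = 2 ^ d / ((n'' : ℝ) + 1) := by
    rw [div_pow, hsplit]; field_simp
  calc 2 * N * β * D * ((k : ℝ) / n) ^ d * (2 * (n'' : ℝ) ^ (d - 1) + (((n'' : ℝ) + 1) ^ d - (n'' : ℝ) ^ d))
      ≤ 2 * N * β * (d : ℝ) ^ 2 * (2 / ((n'' : ℝ) + 1)) ^ d * (((d : ℝ) + 2) * ((n'' : ℝ) + 1) ^ (d - 1)) := by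
        gcongr
    _ = 2 * ((d : ℝ) + 2) * N * (d : ℝ) ^ 2 * β * ((2 / ((n'' : ℝ) + 1)) ^ d * ((n'' : ℝ) + 1) ^ (d - 1)) := by ring
    _ = 2 ^ (d + 1) * ((d : ℝ) + 2) * N * (d : ℝ) ^ 2 * β / ((n'' : ℝ) + 1) := by
        rw [hpow2, pow_succ]; ring

/-- The factor `θ' = (kn''/n)^d` of `F_ge_of_ge` is close to one:
`|θ' - 1| ≤ d/s + d2^{d-1}s/n` (`s = n''+1 ≤ n`, `n ≤ ks ≤ n + s`). [cite: arXiv160201222, Lemma 17.7 (proof)] -/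
theorem abs_theta'_sub_one_le {n'' n k : ℕ} (hn'' : 1 ≤ n'') (hn : n'' + 1 ≤ n)
    (hks1 : (n : ℝ) ≤ (k : ℝ) * ((n'' : ℝ) + 1)) (hks2 : (k : ℝ) * ((n'' : ℝ) + 1) ≤ n + ((n'' : ℝ) + 1)) :
    |((k : ℝ) * n'' / n) ^ d - 1| ≤ (d : ℝ) / ((n'' : ℝ) + 1) + d * 2 ^ (d - 1) * (((n'' : ℝ) + 1) / n) := by
  have hn1 : 1 ≤ n := le_trans (by omega) hn
  have hn0 : (0 : ℝ) < n := by exact_mod_cast hn1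
  have hs0 : (0 : ℝ) < (n'' : ℝ) + 1 := by positivity
  have hn''0 : (0 : ℝ) < n'' := by exact_mod_cast hn''
  have hn''1 : (1 : ℝ) ≤ n'' := by exact_mod_cast hn''
  have hsn : (n'' : ℝ) + 1 ≤ n := by exact_mod_cast hn
  have hk0 : (0 : ℝ) ≤ k := Nat.cast_nonneg k
  have hbase0 : 0 ≤ (k : ℝ) * n'' / n := by positivity
  set θ := ((k : ℝ) * n'' / n) ^ d with hθ
  have hlow : 1 - 1 / ((n'' : ℝ) + 1) ≤ (k : ℝ) * n'' / n := by
    rw [le_div_iff₀ hn0]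
    have e : (1 - 1 / ((n'' : ℝ) + 1)) = n'' / ((n'' : ℝ) + 1) := by field_simp; ring
    rw [e, div_mul_eq_mul_div, div_le_iff₀ hs0]
    nlinarith
  have hup : (k : ℝ) * n'' / n ≤ 1 + ((n'' : ℝ) + 1) / n := by
    rw [div_le_iff₀ hn0, add_mul, one_mul, div_mul_cancel₀ _ hn0.ne']
    nlinarith
  have hθlow : 1 - (d : ℝ) / ((n'' : ℝ) + 1) ≤ θ := by
    have hb : (-2 : ℝ) ≤ -(1 / ((n'' : ℝ) + 1)) := by
      have : 1 / ((n'' : ℝ) + 1) ≤ 1 := by rw [div_le_one hs0]; linarith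
      linarith
    have h1 := one_add_mul_le_pow hb d
    have hnn : 0 ≤ 1 + -(1 / ((n'' : ℝ) + 1)) := by
      have : 1 / ((n'' : ℝ) + 1) ≤ 1 := by rw [div_le_one hs0]; linarith
      linarith
    have h2 : (1 + -(1 / ((n'' : ℝ) + 1))) ^ d ≤ θ := pow_le_pow_left₀ hnn (by linarith) d
    have e : (d : ℝ) * -(1 / ((n'' : ℝ) + 1)) = -((d : ℝ) / ((n'' : ℝ) + 1)) := by ring
    linarith
  have hθup : θ - 1 ≤ d * 2 ^ (d - 1) * (((n'' : ℝ) + 1) / n) := by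
    have hx1 : ((n'' : ℝ) + 1) / n ≤ 1 := by rw [div_le_one hn0]; exact hsn
    have h1 := one_add_pow_sub_one_le (x := ((n'' : ℝ) + 1) / n) (by positivity) hx1 d
    have h2 : θ ≤ (1 + ((n'' : ℝ) + 1) / n) ^ d := pow_le_pow_left₀ hbase0 hup d
    linarith
  have t1 : 0 ≤ (d : ℝ) / ((n'' : ℝ) + 1) := by positivity
  have t2 : 0 ≤ (d : ℝ) * 2 ^ (d - 1) * (((n'' : ℝ) + 1) / n) := by positivity
  rw [abs_le]; constructor <;> linarith

/-- **Going down in the side length** (Lemma 17.5): for `β ≥ 2`, `1 ≤ n''`, `s = n'' + 1 ≤ n`,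
`T(B_n, β) ≥ T(B_{n''}, β) - ((d/s + d2^{d-1}s/n)(K + dN²/2) + (d+1)N²/s) log β - 2^{d+1}(d+2)Nd²β/s`. [cite: arXiv160201222, Lemma 17.7 (proof), Lemma 17.5] -/
theorem T_sub_le_T_of_ge {β : ℝ} (hβ2 : 2 ≤ β) (hd : 1 ≤ d) {n'' n : ℕ} (hn'' : 1 ≤ n'') (hn : n'' + 1 ≤ n) :
    T d N n'' β -
        (((d : ℝ) / ((n'' : ℝ) + 1) + d * 2 ^ (d - 1) * (((n'' : ℝ) + 1) / n)) * (Kc d N + d * (N : ℝ) ^ 2 / 2) +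
            ((d : ℝ) + 1) * (N : ℝ) ^ 2 / ((n'' : ℝ) + 1)) * Real.log β -
        2 ^ (d + 1) * ((d : ℝ) + 2) * N * (d : ℝ) ^ 2 * β / ((n'' : ℝ) + 1) ≤
      T d N n β := by
  have hβ0 : 0 < β := by linarith
  have hL0 : 0 ≤ Real.log β := Real.log_nonneg (by linarith)
  have hn1 : 1 ≤ n := le_trans (by omega) hn
  have hn0 : (0 : ℝ) < n := by exact_mod_cast hn1
  have hs0 : (0 : ℝ) < (n'' : ℝ) + 1 := by positivity
  have hn''0 : (0 : ℝ) < n'' := by exact_mod_cast hn''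
  have hF := F_ge_of_ge (d := d) (N := N) hβ0.le hn'' hn
  set k : ℕ := n / (n'' + 1) + 1 with hk
  -- `k s ∈ [n, n + s]`
  have hks1 : (n : ℝ) ≤ (k : ℝ) * ((n'' : ℝ) + 1) := by
    have h := Nat.lt_div_mul_add (a := n) (b := n'' + 1) (by omega)
    have : n ≤ k * (n'' + 1) := by
      rw [hk, Nat.add_mul, one_mul]; exact h.le
    exact_mod_cast this
  have hks2 : (k : ℝ) * ((n'' : ℝ) + 1) ≤ n + ((n'' : ℝ) + 1) := by
    have : k * (n'' + 1) ≤ n + (n'' + 1) := by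
      rw [hk, Nat.add_mul, one_mul]; exact Nat.add_le_add_right (Nat.div_mul_le_self n (n'' + 1)) _
    exact_mod_cast this
  have hkreal : (((n / (n'' + 1) : ℕ) : ℝ) + 1) = (k : ℝ) := by rw [hk]; push_cast; ring
  rw [hkreal] at hF
  have hJ1 := junk_le (d := d) (N := N) hd hβ0.le hn'' hn hks2
  have hθabs := abs_theta'_sub_one_le (d := d) hn'' hn hks1 hks2
  generalize hJ : 2 * N * β * Fintype.card {q : Fin d × Fin d // q.1 < q.2} * ((k : ℝ) / n) ^ d *
        (2 * (n'' : ℝ) ^ (d - 1) + (((n'' : ℝ) + 1) ^ d - (n'' : ℝ) ^ d)) = J at hF hJ1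
  generalize hθ : ((k : ℝ) * n'' / n) ^ d = θ at hF hθabs
  generalize hy : (d : ℝ) / ((n'' : ℝ) + 1) + d * 2 ^ (d - 1) * (((n'' : ℝ) + 1) / n) = y at hθabs ⊢
  have hy0 : 0 ≤ y := le_trans (abs_nonneg _) hθabs
  -- assemble
  have habsT := abs_T_le (d := d) (N := N) hβ2 n''
  have hKT : |T d N n'' β| ≤ Kc d N * Real.log β := by unfold Kc; exact habsT
  have hθT := sub_abs_mul_le_theta_mul θ (T d N n'' β)
  have hcabs := abs_coef_sub_le (d := d) hd hn'' (show n'' ≤ n by omega)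
  have hcn''le := coef_le (d := d) n''
  have hcn''0 := coef_nonneg (d := d) n''
  have hN2 : (0 : ℝ) ≤ (N : ℝ) ^ 2 := by positivity
  have hTn : θ * T d N n'' β - (θ * coef d n'' - coef d n) / 2 * (N : ℝ) ^ 2 * Real.log β - J ≤ T d N n β := by
    have e : T d N n β = F d N n β + coef d n / 2 * (N : ℝ) ^ 2 * Real.log β := rfl
    have e' : T d N n'' β = F d N n'' β + coef d n'' / 2 * (N : ℝ) ^ 2 * Real.log β := rfl
    rw [e, e']; linarith
  have p1 : |θ - 1| * |T d N n'' β| ≤ y * (Kc d N * Real.log β) :=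
    mul_le_mul hθabs hKT (abs_nonneg _) hy0
  have h1s : 1 / (n'' : ℝ) ≤ 2 / ((n'' : ℝ) + 1) := by
    rw [div_le_div_iff₀ hn''0 hs0]; have : (1:ℝ) ≤ n'' := by exact_mod_cast hn''
    linarith
  have hc2 : |θ * coef d n'' - coef d n| ≤ y * d + 2 * ((d : ℝ) + 1) / ((n'' : ℝ) + 1) := by
    have e1 : |(θ - 1) * coef d n''| ≤ y * d := by
      rw [abs_mul, abs_of_nonneg hcn''0]; exact mul_le_mul hθabs hcn''le hcn''0 hy0
    have e2 : |coef d n'' - coef d n| ≤ 2 * ((d : ℝ) + 1) / ((n'' : ℝ) + 1) := by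
      rw [abs_sub_comm]
      calc |coef d n - coef d n''| ≤ ((d : ℝ) + 1) / n'' := hcabs
        _ = ((d : ℝ) + 1) * (1 / n'') := by ring
        _ ≤ ((d : ℝ) + 1) * (2 / ((n'' : ℝ) + 1)) := by gcongr
        _ = 2 * ((d : ℝ) + 1) / ((n'' : ℝ) + 1) := by ring
    calc |θ * coef d n'' - coef d n| = |(θ - 1) * coef d n'' + (coef d n'' - coef d n)| := by ring_nf
      _ ≤ |(θ - 1) * coef d n''| + |coef d n'' - coef d n| := abs_add_le _ _
      _ ≤ _ := add_le_add e1 e2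
  have p2 : |(θ * coef d n'' - coef d n) / 2 * (N : ℝ) ^ 2 * Real.log β| ≤
      (y * d + 2 * ((d : ℝ) + 1) / ((n'' : ℝ) + 1)) / 2 * (N : ℝ) ^ 2 * Real.log β := by
    rw [abs_mul, abs_mul, abs_div, abs_of_nonneg hN2, abs_of_nonneg hL0, abs_two]
    gcongr
  have p3 := le_abs_self ((θ * coef d n'' - coef d n) / 2 * (N : ℝ) ^ 2 * Real.log β)
  have heq : (y * (Kc d N + d * (N : ℝ) ^ 2 / 2) + ((d : ℝ) + 1) * (N : ℝ) ^ 2 / ((n'' : ℝ) + 1)) * Real.log β =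
      y * (Kc d N * Real.log β) + (y * d + 2 * ((d : ℝ) + 1) / ((n'' : ℝ) + 1)) / 2 * (N : ℝ) ^ 2 * Real.log β := by
    ring
  rw [heq]
  linarith


/-! ### Lemma 17.7: the scales of the lower bound -/

/-- `√β · β^{-2/5} = β^{1/10}`. [folklore] -/
theorem sqrt_mul_r_eq {β : ℝ} (hβ : 0 < β) : Real.sqrt β * β ^ (-(2 / 5 : ℝ)) = β ^ (1 / 10 : ℝ) := by
  rw [Real.sqrt_eq_rpow, ← Real.rpow_add hβ]; norm_num

/-- `β (β^{-2/5})³ = β^{-1/5}`. [folklore] -/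
theorem mul_r_cube_eq {β : ℝ} (hβ : 0 < β) : β * (β ^ (-(2 / 5 : ℝ))) ^ 3 = β ^ (-(1 / 5 : ℝ)) := by
  rw [← Real.rpow_natCast, ← Real.rpow_mul hβ.le]
  conv_lhs => rw [show β = β ^ (1 : ℝ) from (Real.rpow_one β).symm]
  rw [← Real.rpow_mul hβ.le, ← Real.rpow_add hβ]; norm_num

/-- The common error `coef(n)N² log κ(r) + 67βNr³d² ≤ 3dN²β^{-2/5} + 67d²Nβ^{-1/5}` at `r = β^{-2/5} ≤ 1/2`. [cite: arXiv160201222, Lemma 17.6 (proof, `c = 2/5`)] -/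
theorem common_err_le {β : ℝ} (hβ : 0 < β) (hr2 : β ^ (-(2 / 5 : ℝ)) ≤ 1 / 2) (n : ℕ) :
    coef d n * (N : ℝ) ^ 2 * Real.log (κ (β ^ (-(2 / 5 : ℝ)))) + 67 * β * N * (β ^ (-(2 / 5 : ℝ))) ^ 3 * ((d : ℝ) * d) ≤
      3 * d * (N : ℝ) ^ 2 * β ^ (-(2 / 5 : ℝ)) + 67 * (d : ℝ) ^ 2 * N * β ^ (-(1 / 5 : ℝ)) := by
  set r := β ^ (-(2 / 5 : ℝ)) with hr
  have hr0 : 0 ≤ r := Real.rpow_nonneg hβ.le _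
  have hlog := log_kappa_le hr0 hr2
  have hc := coef_le (d := d) n
  have hc0 := coef_nonneg (d := d) n
  have hN2 : (0 : ℝ) ≤ (N : ℝ) ^ 2 := by positivity
  have h1 : coef d n * (N : ℝ) ^ 2 * Real.log (κ r) ≤ 3 * d * (N : ℝ) ^ 2 * r := by
    calc coef d n * (N : ℝ) ^ 2 * Real.log (κ r) ≤ coef d n * (N : ℝ) ^ 2 * (3 * r) := by
          exact mul_le_mul_of_nonneg_left hlog (by positivity)
      _ ≤ d * (N : ℝ) ^ 2 * (3 * r) := by gcongr
      _ = 3 * d * (N : ℝ) ^ 2 * r := by ring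
  have h2 : 67 * β * N * r ^ 3 * ((d : ℝ) * d) = 67 * (d : ℝ) ^ 2 * N * β ^ (-(1 / 5 : ℝ)) := by
    rw [← mul_r_cube_eq hβ, hr]; ring
  linarith

variable (d) in
/-- The majorant `W_e(β) = 2(log(8d) + ed log β)(d²β^{e(d+1)} + 1)` of `R_z(m)² = 2 log(4dm^d+4)/c_m`
over `1 ≤ m ≤ β^e`. [folklore] -/
def Wfun (e β : ℝ) : ℝ := 2 * (Real.log (8 * d) + e * d * Real.log β) * ((d : ℝ) ^ 2 * β ^ (e * ((d : ℝ) + 1)) + 1)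

/-- `2 log(4dm^d + 4)/c_m ≤ W_e(β)` for `1 ≤ m ≤ β^e`, `β ≥ 1`, `d ≥ 1`. [folklore] -/
theorem Rz_sq_le_Wfun (hd : 1 ≤ d) {e β : ℝ} (hβ : 1 ≤ β) {m : ℕ} (hm1 : 1 ≤ m)
    (hm : (m : ℝ) ≤ β ^ e) :
    2 * Real.log (4 * ((d : ℝ) * (m : ℝ) ^ d) + 4) / cLow d m ≤ Wfun d e β := by
  have hβ0 : 0 < β := by linarith
  have hm0 : (0 : ℝ) ≤ m := Nat.cast_nonneg m
  have hm1' : (1 : ℝ) ≤ m := by exact_mod_cast hm1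
  have hd1 : (1 : ℝ) ≤ d := by exact_mod_cast hd
  have hlogβ : 0 ≤ Real.log β := Real.log_nonneg hβ
  have hmd : (m : ℝ) ^ d ≤ β ^ (e * d) := by
    rw [Real.rpow_mul hβ0.le, Real.rpow_natCast]; exact pow_le_pow_left₀ hm0 hm d
  have hmd1 : (m : ℝ) ^ (d + 1) ≤ β ^ (e * ((d : ℝ) + 1)) := by
    rw [Real.rpow_mul hβ0.le, show ((d : ℝ) + 1) = ((d + 1 : ℕ) : ℝ) by push_cast; ring, Real.rpow_natCast]
    exact pow_le_pow_left₀ hm0 hm (d + 1)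
  -- the logarithm
  have hdm : (1 : ℝ) ≤ (d : ℝ) * (m : ℝ) ^ d := by
    have : (1 : ℝ) ≤ (m : ℝ) ^ d := one_le_pow₀ hm1'
    nlinarith
  have hlog : Real.log (4 * ((d : ℝ) * (m : ℝ) ^ d) + 4) ≤ Real.log (8 * d) + e * d * Real.log β := by
    have hle : 4 * ((d : ℝ) * (m : ℝ) ^ d) + 4 ≤ 8 * d * β ^ (e * d) := by nlinarith
    calc Real.log (4 * ((d : ℝ) * (m : ℝ) ^ d) + 4) ≤ Real.log (8 * d * β ^ (e * d)) :=
          Real.log_le_log (by positivity) hle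
      _ = Real.log (8 * d) + e * d * Real.log β := by
          rw [Real.log_mul (by positivity) (by positivity), Real.log_rpow hβ0]
  have hlog0 : 0 ≤ Real.log (4 * ((d : ℝ) * (m : ℝ) ^ d) + 4) := Real.log_nonneg (by nlinarith)
  -- the inverse eigenvalue bound
  have hc : (cLow d m)⁻¹ = (d : ℝ) ^ 2 * (m : ℝ) ^ (d + 1) + 1 := by rw [cLow, inv_inv]
  have hcle : (cLow d m)⁻¹ ≤ (d : ℝ) ^ 2 * β ^ (e * ((d : ℝ) + 1)) + 1 := by rw [hc]; gcongr
  rw [div_eq_mul_inv, Wfun]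
  have h8 : 0 ≤ Real.log (8 * d) + e * d * Real.log β := le_trans hlog0 hlog
  calc 2 * Real.log (4 * ((d : ℝ) * (m : ℝ) ^ d) + 4) * (cLow d m)⁻¹
      ≤ 2 * (Real.log (8 * d) + e * d * Real.log β) * (cLow d m)⁻¹ := by
        gcongr; exact (inv_pos.2 cLow_pos).le
    _ ≤ 2 * (Real.log (8 * d) + e * d * Real.log β) * ((d : ℝ) ^ 2 * β ^ (e * ((d : ℝ) + 1)) + 1) := by
        gcongr

/-- `W_e(β)/β^{1/5} → 0` when `e(d+1) < 1/5`. [folklore] -/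
theorem tendsto_Wfun_div {e : ℝ} (he : e * ((d : ℝ) + 1) < 1 / 5) :
    Tendsto (fun β : ℝ => Wfun d e β / β ^ (1 / 5 : ℝ)) atTop (𝓝 0) := by
  -- `W/β^{1/5} = 2 (log(8d) + ed log β) (d² β^{e(d+1)-1/5} + β^{-1/5})`
  have h1 : Tendsto (fun β : ℝ => β ^ (e * ((d : ℝ) + 1) - 1 / 5)) atTop (𝓝 0) := by
    have : e * ((d : ℝ) + 1) - 1 / 5 = -(1 / 5 - e * ((d : ℝ) + 1)) := by ring
    rw [this]; exact tendsto_rpow_neg_atTop (by linarith)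
  have h2 : Tendsto (fun β : ℝ => β ^ (e * ((d : ℝ) + 1) - 1 / 5) * Real.log β) atTop (𝓝 0) :=
    tendsto_rpow_mul_log (by linarith)
  have h3 : Tendsto (fun β : ℝ => β ^ (-(1 / 5 : ℝ))) atTop (𝓝 0) := tendsto_rpow_neg_atTop (by norm_num)
  have h4 : Tendsto (fun β : ℝ => β ^ (-(1 / 5 : ℝ)) * Real.log β) atTop (𝓝 0) :=
    tendsto_rpow_mul_log (by norm_num)
  have hlim : Tendsto (fun β : ℝ => 2 * (Real.log (8 * d) * ((d : ℝ) ^ 2 * β ^ (e * ((d : ℝ) + 1) - 1 / 5) + β ^ (-(1 / 5 : ℝ))) +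
      e * d * ((d : ℝ) ^ 2 * (β ^ (e * ((d : ℝ) + 1) - 1 / 5) * Real.log β) + β ^ (-(1 / 5 : ℝ)) * Real.log β)))
      atTop (𝓝 0) := by
    have := ((((h1.const_mul ((d : ℝ) ^ 2)).add h3).const_mul (Real.log (8 * d))).add
      (((h2.const_mul ((d : ℝ) ^ 2)).add h4).const_mul (e * d))).const_mul 2
    simpa using this
  refine hlim.congr' ?_
  filter_upwards [eventually_gt_atTop 0] with β hβ
  rw [Wfun, Real.rpow_sub hβ, Real.rpow_neg hβ.le]
  field_simp

variable (d) in
/-- The majorant `R_b(β) = 16d²β^{ed}(d²β^{e(d+1)} + 1) + W_e(β)^{1/2}` of the Theorem-14.2 radius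
`R₀(m, η)` over `m ≤ β^e`, `η ≤ 1`. [folklore] -/
def Rbfun (e β : ℝ) : ℝ :=
  16 * (d : ℝ) ^ 2 * β ^ (e * d) * ((d : ℝ) ^ 2 * β ^ (e * ((d : ℝ) + 1)) + 1) + Real.sqrt (Wfun d e β)

/-- `R₀(m, η) ≤ R_b(β)` for `1 ≤ m ≤ β^e`, `0 < η ≤ 1`, `β ≥ 1`, `d ≥ 1`. [cite: arXiv160201222, Thm. 14.3] -/
theorem R0_le_Rbfun (hd : 1 ≤ d) {e β : ℝ} (hβ : 1 ≤ β) {m : ℕ} (hm1 : 1 ≤ m)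
    (hm : (m : ℝ) ≤ β ^ e) {η : ℝ} (hη0 : 0 < η) (hη1 : η ≤ 1) :
    R0 d m η ≤ Rbfun d e β := by
  have hβ0 : 0 < β := by linarith
  have hm0 : (0 : ℝ) ≤ m := Nat.cast_nonneg m
  have hW := Rz_sq_le_Wfun (d := d) hd hβ hm1 hm
  have hc : (cLow d m)⁻¹ = (d : ℝ) ^ 2 * (m : ℝ) ^ (d + 1) + 1 := by rw [cLow, inv_inv]
  have hmd : (m : ℝ) ^ d ≤ β ^ (e * d) := by
    rw [Real.rpow_mul hβ0.le, Real.rpow_natCast]; exact pow_le_pow_left₀ hm0 hm d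
  have hmd1 : (m : ℝ) ^ (d + 1) ≤ β ^ (e * ((d : ℝ) + 1)) := by
    rw [Real.rpow_mul hβ0.le, show ((d : ℝ) + 1) = ((d + 1 : ℕ) : ℝ) by push_cast; ring, Real.rpow_natCast]
    exact pow_le_pow_left₀ hm0 hm (d + 1)
  have hP : (#(plaquettesIn (halfOpenBox d m)) : ℝ) ≤ d * d * (m : ℝ) ^ d := by
    exact_mod_cast card_plaquettesIn_le (d := d) m
  unfold R0 Rbfun
  have t1 : 16 * (#(plaquettesIn (halfOpenBox d m)) : ℝ) * η / cLow d m ≤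
      16 * (d : ℝ) ^ 2 * β ^ (e * d) * ((d : ℝ) ^ 2 * β ^ (e * ((d : ℝ) + 1)) + 1) := by
    rw [div_eq_mul_inv, hc]
    calc 16 * (#(plaquettesIn (halfOpenBox d m)) : ℝ) * η * ((d : ℝ) ^ 2 * (m : ℝ) ^ (d + 1) + 1)
        ≤ 16 * (d * d * (m : ℝ) ^ d) * 1 * ((d : ℝ) ^ 2 * (m : ℝ) ^ (d + 1) + 1) := by gcongr
      _ ≤ 16 * (d * d * β ^ (e * d)) * 1 * ((d : ℝ) ^ 2 * β ^ (e * ((d : ℝ) + 1)) + 1) := by gcongr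
      _ = _ := by ring
  have t2 : Real.sqrt (2 * Real.log (4 * (d * (m : ℝ) ^ d) + 4) / cLow d m) ≤ Real.sqrt (Wfun d e β) :=
    Real.sqrt_le_sqrt hW
  exact add_le_add t1 t2

/-- `R_b(β)/β^{1/10} → 0` when `e(2d+1) < 1/10` (hence `e(d+1) < 1/5`). [folklore] -/
theorem tendsto_Rbfun_div (hd : 1 ≤ d) {e : ℝ} (he0 : 0 ≤ e) (he : e * (2 * (d : ℝ) + 1) < 1 / 10) :
    Tendsto (fun β : ℝ => Rbfun d e β / β ^ (1 / 10 : ℝ)) atTop (𝓝 0) := by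
  have hd1 : (1 : ℝ) ≤ d := by exact_mod_cast hd
  have he' : e * ((d : ℝ) + 1) < 1 / 5 := by nlinarith
  -- polynomial part
  have p1 : Tendsto (fun β : ℝ => β ^ (e * (2 * (d : ℝ) + 1) - 1 / 10)) atTop (𝓝 0) := by
    have : e * (2 * (d : ℝ) + 1) - 1 / 10 = -(1 / 10 - e * (2 * (d : ℝ) + 1)) := by ring
    rw [this]; exact tendsto_rpow_neg_atTop (by linarith)
  have p2 : Tendsto (fun β : ℝ => β ^ (e * d - 1 / 10)) atTop (𝓝 0) := by
    have : e * (d : ℝ) - 1 / 10 = -(1 / 10 - e * d) := by ring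
    rw [this]; exact tendsto_rpow_neg_atTop (by nlinarith)
  -- the square root part: `√W/β^{1/10} = √(W/β^{1/5})`
  have p3 : Tendsto (fun β : ℝ => Real.sqrt (Wfun d e β / β ^ (1 / 5 : ℝ))) atTop (𝓝 0) := by
    simpa using (tendsto_Wfun_div (d := d) he').sqrt
  have hlim : Tendsto (fun β : ℝ => 16 * (d : ℝ) ^ 2 * ((d : ℝ) ^ 2 * β ^ (e * (2 * (d : ℝ) + 1) - 1 / 10) + β ^ (e * d - 1 / 10)) +
      Real.sqrt (Wfun d e β / β ^ (1 / 5 : ℝ))) atTop (𝓝 0) := by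
    simpa using (((p1.const_mul ((d : ℝ) ^ 2)).add p2).const_mul (16 * (d : ℝ) ^ 2)).add p3
  refine hlim.congr' ?_
  filter_upwards [eventually_gt_atTop 0] with β hβ
  have hβ10 : 0 < β ^ (1 / 10 : ℝ) := Real.rpow_pos_of_pos hβ _
  have hsq : Real.sqrt (Wfun d e β / β ^ (1 / 5 : ℝ)) = Real.sqrt (Wfun d e β) / β ^ (1 / 10 : ℝ) := by
    rw [Real.sqrt_div' _ (Real.rpow_nonneg hβ.le _)]
    congr 1
    rw [Real.sqrt_eq_rpow, ← Real.rpow_mul hβ.le]; norm_num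
  rw [hsq, Rbfun, Real.rpow_sub hβ, Real.rpow_sub hβ, add_div]
  congr 1
  have e1 : β ^ (e * (2 * (d : ℝ) + 1)) = β ^ (e * d) * β ^ (e * ((d : ℝ) + 1)) := by
    rw [← Real.rpow_add hβ]; congr 1; ring
  rw [e1]
  field_simp


/-! ### Lemma 17.7: exponents, error majorants and their limits -/

variable (d) in
/-- The exponent `c = 1/(10(d+2))` below which (`n ≤ β^c`) the union bound suffices. [folklore] -/
def cL : ℝ := 1 / (10 * ((d : ℝ) + 2))

variable (d) in
/-- The exponent `b = 1/(40(d+2))` of the block size `m = ⌊β^b⌋` in Theorem 14.3. [cite: arXiv160201222, Lemma 17.6 (proof, choice of `m`)] -/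
def bL : ℝ := 1 / (40 * ((d : ℝ) + 2))

/-- `c > 0`. [folklore] -/
theorem cL_pos : 0 < cL d := by unfold cL; positivity
/-- `b > 0`. [folklore] -/
theorem bL_pos : 0 < bL d := by unfold bL; positivity

/-- `c(d+1) < 1/5`. [folklore] -/
theorem cL_mul_lt : cL d * ((d : ℝ) + 1) < 1 / 5 := by
  unfold cL
  have hd : (0 : ℝ) ≤ d := Nat.cast_nonneg d
  rw [div_mul_eq_mul_div, one_mul, div_lt_div_iff₀ (by positivity) (by norm_num)]
  nlinarith

/-- `b(2d+1) < 1/10`. [folklore] -/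
theorem bL_mul_lt : bL d * (2 * (d : ℝ) + 1) < 1 / 10 := by
  unfold bL
  have hd : (0 : ℝ) ≤ d := Nat.cast_nonneg d
  rw [div_mul_eq_mul_div, one_mul, div_lt_div_iff₀ (by positivity) (by norm_num)]
  nlinarith

/-- `b < c`. [folklore] -/
theorem bL_lt_cL : bL d < cL d := by
  unfold bL cL
  have hd : (0 : ℝ) ≤ d := Nat.cast_nonneg d
  exact one_div_lt_one_div_of_lt (by positivity) (by nlinarith)

/-- `b < 1`. [folklore] -/
theorem bL_lt_one : bL d < 1 := by
  unfold bL
  have hd : (0 : ℝ) ≤ d := Nat.cast_nonneg d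
  rw [div_lt_one (by positivity)]; nlinarith

variable (d N) in
/-- The common error `3dN²β^{-2/5} + 67d²Nβ^{-1/5}` of the lower bound. [cite: arXiv160201222, Lemma 17.6] -/
def e0 (β : ℝ) : ℝ := 3 * d * (N : ℝ) ^ 2 * β ^ (-(2 / 5 : ℝ)) + 67 * (d : ℝ) ^ 2 * N * β ^ (-(1 / 5 : ℝ))

/-- `e₀(β) → 0`. [folklore] -/
theorem tendsto_e0 : Tendsto (e0 d N) atTop (𝓝 0) := by
  have h1 : Tendsto (fun β : ℝ => β ^ (-(2 / 5 : ℝ))) atTop (𝓝 0) := tendsto_rpow_neg_atTop (by norm_num)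
  have h2 : Tendsto (fun β : ℝ => β ^ (-(1 / 5 : ℝ))) atTop (𝓝 0) := tendsto_rpow_neg_atTop (by norm_num)
  have h := (h1.const_mul (3 * d * (N : ℝ) ^ 2)).add (h2.const_mul (67 * (d : ℝ) ^ 2 * N))
  simp only [mul_zero, add_zero] at h
  exact h.congr' (Eventually.of_forall fun β => by simp only [e0])

variable (d) in
/-- A majorant of the per-edge cost `B(n')` over `n' ≤ 3β³`. [folklore] -/
def Bbar (β : ℝ) : ℝ := (2 * d + 1) * (Real.log 3 + 3 * Real.log β) + (Real.log d + 8 * (d : ℝ) ^ 2 + 2)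

/-- `B(n) ≤ B̄(β)` for `1 ≤ n ≤ 3β³`. [folklore] -/
theorem Bcost_le_Bbar {β : ℝ} (hβ : 1 ≤ β) {n : ℕ} (hn1 : 1 ≤ n) (hn : (n : ℝ) ≤ 3 * β ^ 3) :
    Bcost d n ≤ Bbar d β := by
  unfold Bcost Bbar
  have hn0 : (0 : ℝ) < n := by exact_mod_cast hn1
  have hβ0 : 0 < β := by linarith
  have hlog : Real.log n ≤ Real.log 3 + 3 * Real.log β := by
    calc Real.log n ≤ Real.log (3 * β ^ 3) := Real.log_le_log hn0 hn
      _ = Real.log 3 + 3 * Real.log β := by rw [Real.log_mul (by norm_num) (by positivity), Real.log_pow]; push_cast; ring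
  have : (0 : ℝ) ≤ 2 * d + 1 := by positivity
  nlinarith

variable (d N) in
/-- The Theorem-14.3 error `N²(2 log 2/β^b + 8d² B̄(β)/β^b)` of the lower bound. [cite: arXiv160201222, Lemma 17.6] -/
def errLB (β : ℝ) : ℝ := (N : ℝ) ^ 2 * (2 * Real.log 2 / β ^ bL d + 8 * (d : ℝ) ^ 2 * Bbar d β / β ^ bL d)

/-- `err_LB(β) → 0`. [folklore] -/
theorem tendsto_errLB : Tendsto (errLB d N) atTop (𝓝 0) := by
  have hb := bL_pos (d := d)
  have h1 : Tendsto (fun β : ℝ => 2 * Real.log 2 / β ^ bL d) atTop (𝓝 0) :=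
    tendsto_const_nhds.div_atTop (tendsto_rpow_atTop hb)
  have h2 : Tendsto (fun β : ℝ => Bbar d β / β ^ bL d) atTop (𝓝 0) := by
    have hl := tendsto_log_div_rpow' (s := bL d) hb
    have hc : Tendsto (fun β : ℝ => ((2 * d + 1) * Real.log 3 + (Real.log d + 8 * (d : ℝ) ^ 2 + 2)) / β ^ bL d) atTop (𝓝 0) :=
      tendsto_const_nhds.div_atTop (tendsto_rpow_atTop hb)
    have := hc.add (hl.const_mul ((2 * (d : ℝ) + 1) * 3))
    simp only [zero_add, mul_zero] at this
    refine this.congr' (Eventually.of_forall fun β => ?_)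
    simp only [Bbar]; ring
  have := (h1.add (h2.const_mul (8 * (d : ℝ) ^ 2))).const_mul ((N : ℝ) ^ 2)
  simp only [mul_zero, add_zero] at this
  refine this.congr' (Eventually.of_forall fun β => ?_)
  simp only [errLB]; ring

variable (d N) in
/-- The error of the descent `n → n'' ≍ β^{2+b}` (Lemma 17.5) for `n > β³`. [cite: arXiv160201222, Lemma 17.7 (proof)] -/
def JD (β : ℝ) : ℝ :=
  ((d : ℝ) / β ^ 2 + 3 * d * 2 ^ (d - 1) * (β ^ bL d / β)) * (Kc d N + d * (N : ℝ) ^ 2 / 2) * Real.log β +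
    ((d : ℝ) + 1) * (N : ℝ) ^ 2 * (Real.log β / β ^ 2) + 2 ^ (d + 1) * ((d : ℝ) + 2) * N * (d : ℝ) ^ 2 / β

/-- `J_D(β) → 0`. [folklore] -/
theorem tendsto_JD : Tendsto (JD d N) atTop (𝓝 0) := by
  have hb := bL_pos (d := d)
  have hb1 := bL_lt_one (d := d)
  have h1 : Tendsto (fun β : ℝ => Real.log β / β ^ 2) atTop (𝓝 0) := by
    have := tendsto_log_div_rpow' (s := 2) (by norm_num)
    refine this.congr' (Eventually.of_forall fun β => ?_); norm_num
  have h2 : Tendsto (fun β : ℝ => (β ^ bL d / β) * Real.log β) atTop (𝓝 0) := by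
    have := tendsto_rpow_mul_log (p := bL d - 1) (by linarith)
    refine this.congr' ?_
    filter_upwards [eventually_gt_atTop 0] with β hβ
    rw [Real.rpow_sub_one hβ.ne']
  have h3 : Tendsto (fun β : ℝ => (1 : ℝ) / β) atTop (𝓝 0) := tendsto_const_nhds.div_atTop tendsto_id
  have h1' : Tendsto (fun β : ℝ => (1 / β ^ 2) * Real.log β) atTop (𝓝 0) := by
    refine h1.congr' (Eventually.of_forall fun β => ?_); ring
  have := ((((h1'.const_mul (d : ℝ)).add (h2.const_mul (3 * (d : ℝ) * 2 ^ (d - 1)))).mul_const (Kc d N + d * (N : ℝ) ^ 2 / 2)).add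
    (h1.const_mul (((d : ℝ) + 1) * (N : ℝ) ^ 2))).add (h3.const_mul (2 ^ (d + 1) * ((d : ℝ) + 2) * N * (d : ℝ) ^ 2))
  simp only [mul_zero, zero_mul, add_zero] at this
  refine this.congr' (Eventually.of_forall fun β => ?_)
  simp only [JD]; ring


/-! ### Lemma 17.7: the three regimes -/

/-- `√β r/N = β^{1/10}/N` at `r = β^{-2/5}`. [folklore] -/
theorem Rprime_eq {β : ℝ} (hβ : 0 < β) : Real.sqrt β * β ^ (-(2 / 5 : ℝ)) / N = β ^ (1 / 10 : ℝ) / N := by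
  rw [sqrt_mul_r_eq hβ]

/-- **Regime A (`n ≤ β^c`)**: the union bound supplies `L = 1/2`, and
`T(B_n, β) ≥ G(n) - e₀(β) - N² log 2/n^d`. [cite: arXiv160201222, Lemma 17.6] -/
theorem lowA (hN : 1 ≤ N) (hd : 1 ≤ d) {β : ℝ} (hβ2 : 2 ≤ β) (hr2 : β ^ (-(2 / 5 : ℝ)) ≤ 1 / 2)
    (hW : Wfun d (cL d) β / β ^ (1 / 5 : ℝ) ≤ 1 / (N : ℝ) ^ 2) {n : ℕ} (hn1 : 1 ≤ n)
    (hn : (n : ℝ) ≤ β ^ cL d) :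
    G d N n - e0 d N β - (N : ℝ) ^ 2 * (Real.log 2 / (n : ℝ) ^ d) ≤ T d N n β := by
  have hβ0 : 0 < β := by linarith
  have hβ1 : 1 ≤ β := by linarith
  have hN0 : (0 : ℝ) < N := by exact_mod_cast hN
  set r := β ^ (-(2 / 5 : ℝ)) with hr
  have hr0 : 0 < r := Real.rpow_pos_of_pos hβ0 _
  have hβ5 : 0 < β ^ (1 / 5 : ℝ) := Real.rpow_pos_of_pos hβ0 _
  -- `R_z(n) ≤ β^{1/10}/N`
  have hWle : Wfun d (cL d) β ≤ β ^ (1 / 5 : ℝ) / (N : ℝ) ^ 2 := by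
    rw [div_le_iff₀ hβ5] at hW; rw [div_eq_mul_one_div, mul_comm]; exact hW
  have hRz2 : Rz d n ^ 2 ≤ β ^ (1 / 5 : ℝ) / (N : ℝ) ^ 2 := by
    rw [Rz, Real.sq_sqrt (div_nonneg (mul_nonneg zero_le_two (Real.log_nonneg (by
      have : (0:ℝ) ≤ 4 * ((d : ℝ) * (n : ℝ) ^ d) := by positivity
      linarith))) cLow_pos.le)]
    exact (Rz_sq_le_Wfun (d := d) hd hβ1 hn1 hn).trans hWle
  have hx : Rz d n ≤ Real.sqrt β * r / N := by
    rw [hr, Rprime_eq hβ0]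
    have h10 : β ^ (1 / 10 : ℝ) / N = Real.sqrt (β ^ (1 / 5 : ℝ) / (N : ℝ) ^ 2) := by
      rw [Real.sqrt_div' _ (by positivity), Real.sqrt_sq hN0.le, Real.sqrt_eq_rpow, ← Real.rpow_mul hβ0.le]
      norm_num
    rw [h10]
    exact (Real.le_sqrt (Rz_nonneg n) (by positivity)).2 hRz2
  have h := G_sub_le_T_small (d := d) hβ2 hN hn1 hr0 hr2 hx
  have hc := common_err_le (d := d) (N := N) hβ0 hr2 n
  rw [← hr] at hc
  unfold e0
  linarith

/-- **Regime B (special side length `n = ρ(m-1)+1`, `m ≍ β^b`)**: Theorem 14.3 supplies `L`, and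
`T(B_n, β) ≥ G(n) - e₀(β) - err_LB(β)` provided `n ≤ 3β³`. [cite: arXiv160201222, Lemma 17.6] -/
theorem lowB (hN : 1 ≤ N) (hd : 1 ≤ d) {β : ℝ} (hβ2 : 2 ≤ β) (hr2 : β ^ (-(2 / 5 : ℝ)) ≤ 1 / 2)
    (hN10 : (N : ℝ) ≤ β ^ (1 / 10 : ℝ)) (hRb : Rbfun d (bL d) β / β ^ (1 / 10 : ℝ) ≤ 1 / N)
    (hb4 : 4 ≤ β ^ bL d) {m ρ : ℕ} (hmb : (m : ℝ) ≤ β ^ bL d) (hmb' : β ^ bL d - 1 ≤ m) (hρ : 1 ≤ ρ)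
    (hn3 : (fineN m ρ : ℝ) ≤ 3 * β ^ 3) :
    G d N (fineN m ρ) - e0 d N β - errLB d N β ≤ T d N (fineN m ρ) β := by
  have hβ0 : 0 < β := by linarith
  have hβ1 : 1 ≤ β := by linarith
  have hN0 : (0 : ℝ) < N := by exact_mod_cast hN
  have hm3r : (3 : ℝ) ≤ m := by linarith
  have hm3 : 3 ≤ m := by exact_mod_cast hm3r
  have hm1 : 1 ≤ m := by omega
  have hm2 : 2 ≤ m := by omega
  set n := fineN m ρ with hn
  have hn1 : 1 ≤ n := by rw [hn, fineN]; omega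
  have hn0 : (0 : ℝ) < n := by exact_mod_cast hn1
  have hnd : (1 : ℝ) ≤ (n : ℝ) ^ d := one_le_pow₀ (by exact_mod_cast hn1)
  set r := β ^ (-(2 / 5 : ℝ)) with hr
  have hr0 : 0 < r := Real.rpow_pos_of_pos hβ0 _
  have hβ10 : 0 < β ^ (1 / 10 : ℝ) := Real.rpow_pos_of_pos hβ0 _
  set η : ℝ := ((n : ℝ) ^ d)⁻¹ with hηdef
  have hη0 : 0 < η := by rw [hηdef]; positivity
  have hη1 : η ≤ 1 := inv_le_one_of_one_le₀ hnd
  have hR'1 : 1 ≤ Real.sqrt β * r / N := by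
    rw [hr, Rprime_eq hβ0, le_div_iff₀ hN0, one_mul]; exact hN10
  have hη : η ≤ Real.sqrt β * r / N := hη1.trans hR'1
  have hRble : Rbfun d (bL d) β ≤ β ^ (1 / 10 : ℝ) / N := by
    rw [div_le_iff₀ hβ10] at hRb; rw [div_eq_mul_one_div, mul_comm]; exact hRb
  have hR : R0 d m η ≤ Real.sqrt β * r / N := by
    rw [hr, Rprime_eq hβ0]
    exact (R0_le_Rbfun (d := d) hd hβ1 hm1 hmb hη0 hη1).trans hRble
  have h := G_sub_le_T_special (d := d) hβ2 hN hd hm2 hρ hr0 hr2 hη hR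
  have hc := common_err_le (d := d) (N := N) hβ0 hr2 n
  rw [← hr] at hc
  -- the Theorem-14.3 error is at most `errLB`
  have hm1r : β ^ bL d / 2 ≤ (m : ℝ) - 1 := by linarith
  have hm1pos : (0 : ℝ) < (m : ℝ) - 1 := by linarith
  have hbpos : 0 < β ^ bL d := by linarith
  have hinv : 1 / ((m : ℝ) - 1) ≤ 2 / β ^ bL d := by
    rw [div_le_div_iff₀ hm1pos hbpos]; linarith
  have hB := Bcost_le_Bbar (d := d) hβ1 hn1 hn3
  have hB0 := Bcost_nonneg (d := d) hd hn1
  have hlog2 : 0 < Real.log 2 := Real.log_pos one_lt_two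
  have t1 : Real.log 2 / ((m : ℝ) - 1) ^ d ≤ 2 * Real.log 2 / β ^ bL d := by
    have hpow : (m : ℝ) - 1 ≤ ((m : ℝ) - 1) ^ d := by
      calc (m : ℝ) - 1 = ((m : ℝ) - 1) ^ 1 := (pow_one _).symm
        _ ≤ ((m : ℝ) - 1) ^ d := pow_le_pow_right₀ (by linarith) hd
    calc Real.log 2 / ((m : ℝ) - 1) ^ d ≤ Real.log 2 / ((m : ℝ) - 1) :=
          div_le_div_of_nonneg_left hlog2.le hm1pos hpow
      _ = Real.log 2 * (1 / ((m : ℝ) - 1)) := by ring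
      _ ≤ Real.log 2 * (2 / β ^ bL d) := by gcongr
      _ = 2 * Real.log 2 / β ^ bL d := by ring
  have t2 : 4 * (d : ℝ) ^ 2 / ((m : ℝ) - 1) * Bcost d n ≤ 8 * (d : ℝ) ^ 2 * Bbar d β / β ^ bL d := by
    calc 4 * (d : ℝ) ^ 2 / ((m : ℝ) - 1) * Bcost d n = 4 * (d : ℝ) ^ 2 * (1 / ((m : ℝ) - 1)) * Bcost d n := by ring
      _ ≤ 4 * (d : ℝ) ^ 2 * (2 / β ^ bL d) * Bbar d β := by gcongr
      _ = 8 * (d : ℝ) ^ 2 * Bbar d β / β ^ bL d := by ring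
  have hN2 : (0 : ℝ) ≤ (N : ℝ) ^ 2 := by positivity
  have t3 : (N : ℝ) ^ 2 * (Real.log 2 / ((m : ℝ) - 1) ^ d + 4 * (d : ℝ) ^ 2 / ((m : ℝ) - 1) * Bcost d n) ≤ errLB d N β := by
    unfold errLB; exact mul_le_mul_of_nonneg_left (add_le_add t1 t2) hN2
  unfold e0
  linarith


/-- `⌊β^b⌋` as the block size: `β^b - 1 ≤ m ≤ β^b`. [folklore] -/
theorem floor_scale {x : ℝ} (hx : 0 ≤ x) : ((⌊x⌋₊ : ℕ) : ℝ) ≤ x ∧ x - 1 ≤ ((⌊x⌋₊ : ℕ) : ℝ) :=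
  ⟨Nat.floor_le hx, by linarith [Nat.lt_floor_add_one x]⟩

/-- **Regime C (`β^c < n ≤ β³`)**: round `n` up to the next special side length `n' = ρ(m-1)+1`
(`m = ⌊β^b⌋`), losing `K₃((n'-n)/n) log β ≤ K₃ β^{b-c} log β`. [cite: arXiv160201222, Lemma 17.7 (proof)] -/
theorem lowC (hN : 1 ≤ N) (hd : 1 ≤ d) {β : ℝ} (hβ2 : 2 ≤ β) (hr2 : β ^ (-(2 / 5 : ℝ)) ≤ 1 / 2)
    (hN10 : (N : ℝ) ≤ β ^ (1 / 10 : ℝ)) (hRb : Rbfun d (bL d) β / β ^ (1 / 10 : ℝ) ≤ 1 / N)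
    (hb4 : 4 ≤ β ^ bL d) {A₁ : ℝ} {n : ℕ} (hnc : β ^ cL d < n) (hn3 : (n : ℝ) ≤ β ^ 3)
    (hGge : ∀ n' : ℕ, n ≤ n' → A₁ ≤ G d N n') :
    A₁ - e0 d N β - errLB d N β - K₃ d N * (β ^ bL d / β ^ cL d * Real.log β) ≤ T d N n β := by
  have hβ0 : 0 < β := by linarith
  have hβ1 : 1 ≤ β := by linarith
  have hL0 : 0 ≤ Real.log β := Real.log_nonneg hβ1
  have hbc : β ^ bL d ≤ β ^ cL d := Real.rpow_le_rpow_of_exponent_le hβ1 (bL_lt_cL (d := d)).le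
  have hc1 : 1 ≤ β ^ cL d := Real.one_le_rpow hβ1 (cL_pos (d := d)).le
  obtain ⟨hmb, hmb'⟩ := floor_scale (Real.rpow_nonneg hβ0.le (bL d))
  set m := ⌊β ^ bL d⌋₊ with hm
  have hm3r : (3 : ℝ) ≤ m := by linarith
  have hm3 : 3 ≤ m := by exact_mod_cast hm3r
  have hn1r : (1 : ℝ) < n := lt_of_le_of_lt hc1 hnc
  have hn2 : 2 ≤ n := by have : (1 : ℕ) < n := by exact_mod_cast hn1r
                         omega
  have hn1 : 1 ≤ n := by omega
  have hn0 : (0 : ℝ) < n := by positivity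
  have hmn : m ≤ n := by
    have : (m : ℝ) ≤ n := by linarith
    exact_mod_cast this
  -- the special side length `n' = ρ(m-1)+1 ∈ [n, n+m-1]`
  set ρ : ℕ := (n - 1) / (m - 1) + 1 with hρ
  have hρ1 : 1 ≤ ρ := Nat.le_add_left 1 _
  set n' := fineN m ρ with hn'
  have hn'eq : n' = ρ * (m - 1) + 1 := rfl
  have hdiv := Nat.lt_div_mul_add (a := n - 1) (b := m - 1) (by omega)
  have hdiv2 := Nat.div_mul_le_self (n - 1) (m - 1)
  have hnn' : n ≤ n' := by
    have : n - 1 < ρ * (m - 1) := by rw [hρ, Nat.add_mul, one_mul]; exact hdiv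
    omega
  have hn'le : n' ≤ n + m - 1 := by
    have : ρ * (m - 1) ≤ (n - 1) + (m - 1) := by rw [hρ, Nat.add_mul, one_mul]; exact Nat.add_le_add_right hdiv2 _
    omega
  have hn'2n : n' ≤ 2 * n := by omega
  have hn'3 : (n' : ℝ) ≤ 3 * β ^ 3 := by
    have : (n' : ℝ) ≤ 2 * n := by exact_mod_cast hn'2n
    nlinarith [Real.rpow_nonneg hβ0.le (3 : ℝ), show (0:ℝ) ≤ β ^ 3 by positivity]
  -- regime B at `n'`
  have hB := lowB (d := d) hN hd hβ2 hr2 hN10 hRb hb4 hmb hmb' hρ1 hn'3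
  -- rounding loss
  have hround := T_sub_le_T_of_le (d := d) (N := N) hd hβ2 hn1 hnn' hn'2n
  have hfrac : ((n' : ℝ) - n) / n ≤ β ^ bL d / β ^ cL d := by
    have h1 : (n' : ℝ) - n ≤ β ^ bL d := by
      have : (n' : ℝ) ≤ n + m - 1 := by
        have h := hn'le
        have : ((n + m - 1 : ℕ) : ℝ) = (n : ℝ) + m - 1 := by
          rw [Nat.cast_sub (by omega)]; push_cast; ring
        rw [← this]; exact_mod_cast h
      linarith
    have h0 : 0 ≤ (n' : ℝ) - n := sub_nonneg.2 (by exact_mod_cast hnn')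
    calc ((n' : ℝ) - n) / n ≤ β ^ bL d / n := div_le_div_of_nonneg_right h1 hn0.le
      _ ≤ β ^ bL d / β ^ cL d := div_le_div_of_nonneg_left (by linarith) (by linarith) hnc.le
  have hK := K₃_nonneg (d := d) (N := N)
  have hloss : K₃ d N * (((n' : ℝ) - n) / n) * Real.log β ≤ K₃ d N * (β ^ bL d / β ^ cL d * Real.log β) := by
    rw [mul_assoc]; exact mul_le_mul_of_nonneg_left (mul_le_mul_of_nonneg_right hfrac hL0) hK
  have hG := hGge n' hnn'
  linarith

/-- Sizes in regime D: with `m = ⌊β^b⌋`, `ρ = ⌈β²⌉`, `n'' = ρ(m-1)+1`: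
`β² ≤ n''+1 ≤ 3β^{2+b}` and `3β^{2+b} + 1 ≤ β³`. [folklore] -/
theorem nD_size {β : ℝ} (hβ2 : 2 ≤ β) (hb4 : 4 ≤ β ^ bL d) (h4 : 4 ≤ β ^ (1 - bL d)) :
    1 ≤ ⌈β ^ 2⌉₊ ∧ β ^ 2 ≤ (fineN ⌊β ^ bL d⌋₊ ⌈β ^ 2⌉₊ : ℝ) + 1 ∧
      (fineN ⌊β ^ bL d⌋₊ ⌈β ^ 2⌉₊ : ℝ) + 1 ≤ 3 * β ^ (2 + bL d) ∧ 3 * β ^ (2 + bL d) + 1 ≤ β ^ 3 := by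
  have hβ0 : 0 < β := by linarith
  have hβ1 : 1 ≤ β := by linarith
  obtain ⟨hmb, hmb'⟩ := floor_scale (Real.rpow_nonneg hβ0.le (bL d))
  set m := ⌊β ^ bL d⌋₊ with hm
  have hm3r : (3 : ℝ) ≤ m := by linarith
  have hm3 : 3 ≤ m := by exact_mod_cast hm3r
  set ρ : ℕ := ⌈β ^ 2⌉₊ with hρ
  have hβsq : (4 : ℝ) ≤ β ^ 2 := by nlinarith
  have hρge : β ^ 2 ≤ ρ := Nat.le_ceil _
  have hρlt : (ρ : ℝ) < β ^ 2 + 1 := Nat.ceil_lt_add_one (by positivity)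
  have hρ1 : 1 ≤ ρ := by
    have : (1 : ℝ) ≤ ρ := by linarith
    exact_mod_cast this
  have hm1r : ((m - 1 : ℕ) : ℝ) = (m : ℝ) - 1 := by rw [Nat.cast_sub (by omega)]; push_cast; ring
  have hn''r : (fineN m ρ : ℝ) = ρ * ((m : ℝ) - 1) + 1 := by
    rw [fineN]; push_cast; rw [hm1r]
  have hpow2b : β ^ 2 * β ^ bL d = β ^ (2 + bL d) := by
    rw [Real.rpow_add hβ0, Real.rpow_two]
  refine ⟨hρ1, ?_, ?_, ?_⟩
  · rw [hn''r]
    have hρ0 : (0 : ℝ) ≤ ρ := Nat.cast_nonneg ρ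
    have : β ^ 2 * 1 ≤ (ρ : ℝ) * ((m : ℝ) - 1) := mul_le_mul hρge (by linarith) zero_le_one hρ0
    linarith
  · rw [hn''r]
    have hb0 : 0 ≤ β ^ bL d := Real.rpow_nonneg hβ0.le _
    have hρ0 : (0 : ℝ) ≤ ρ := Nat.cast_nonneg ρ
    have h1 : (ρ : ℝ) * ((m : ℝ) - 1) ≤ (β ^ 2 + 1) * β ^ bL d := by
      have : (m : ℝ) - 1 ≤ β ^ bL d := by linarith
      calc (ρ : ℝ) * ((m : ℝ) - 1) ≤ ρ * β ^ bL d := by gcongr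
        _ ≤ (β ^ 2 + 1) * β ^ bL d := by gcongr
    have hb2b : β ^ bL d ≤ β ^ (2 + bL d) := Real.rpow_le_rpow_of_exponent_le hβ1 (by linarith)
    have h2b4 : (4 : ℝ) ≤ β ^ (2 + bL d) := by
      rw [← hpow2b]
      calc (4 : ℝ) = 4 * 1 := by norm_num
        _ ≤ β ^ 2 * β ^ bL d := mul_le_mul hβsq (by linarith) zero_le_one (by positivity)
    have : (β ^ 2 + 1) * β ^ bL d = β ^ (2 + bL d) + β ^ bL d := by rw [← hpow2b]; ring
    linarith
  · have e : β ^ (3 : ℕ) = β ^ (1 - bL d) * β ^ (2 + bL d) := by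
      rw [← Real.rpow_add hβ0]; norm_num
    have h2b0 : 0 ≤ β ^ (2 + bL d) := Real.rpow_nonneg hβ0.le _
    have h2b1 : 1 ≤ β ^ (2 + bL d) := Real.one_le_rpow hβ1 (by linarith [bL_pos (d := d)])
    rw [e]
    have := mul_le_mul_of_nonneg_right h4 h2b0
    linarith

/-- The descent junk is at most `J_D(β)` when `β² ≤ s ≤ 3β^{2+b}` and `n > β³`. [folklore] -/
theorem descent_junk_le_JD {β : ℝ} (hβ2 : 2 ≤ β) {s n : ℝ} (hs : β ^ 2 ≤ s) (hsle : s ≤ 3 * β ^ (2 + bL d))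
    (hn : β ^ 3 < n) :
    (((d : ℝ) / s + d * 2 ^ (d - 1) * (s / n)) * (Kc d N + d * (N : ℝ) ^ 2 / 2) +
        ((d : ℝ) + 1) * (N : ℝ) ^ 2 / s) * Real.log β +
      2 ^ (d + 1) * ((d : ℝ) + 2) * N * (d : ℝ) ^ 2 * β / s ≤ JD d N β := by
  have hβ0 : 0 < β := by linarith
  have hL0 : 0 ≤ Real.log β := Real.log_nonneg (by linarith)
  have hβsq : 0 < β ^ 2 := by positivity
  have hs0 : 0 < s := lt_of_lt_of_le hβsq hs
  have hn0 : 0 < n := lt_trans (by positivity) hn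
  have hpow2b : β ^ 2 * β ^ bL d = β ^ (2 + bL d) := by rw [Real.rpow_add hβ0, Real.rpow_two]
  have hK0 : 0 ≤ Kc d N + d * (N : ℝ) ^ 2 / 2 := by have := Kc_nonneg (d := d) (N := N); positivity
  have j1 : (d : ℝ) / s ≤ d / β ^ 2 := div_le_div_of_nonneg_left (Nat.cast_nonneg d) hβsq hs
  have j2 : s / n ≤ 3 * (β ^ bL d / β) := by
    rw [div_le_iff₀ hn0]
    have e : 3 * (β ^ bL d / β) * β ^ 3 = 3 * β ^ (2 + bL d) := by rw [← hpow2b]; field_simp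
    have hc : 0 ≤ 3 * (β ^ bL d / β) := by positivity
    have := mul_le_mul_of_nonneg_left hn.le hc
    linarith
  have j3 : ((d : ℝ) + 1) * (N : ℝ) ^ 2 / s ≤ ((d : ℝ) + 1) * (N : ℝ) ^ 2 * (1 / β ^ 2) := by
    rw [mul_one_div]; exact div_le_div_of_nonneg_left (by positivity) hβsq hs
  have j4 : 2 ^ (d + 1) * ((d : ℝ) + 2) * N * (d : ℝ) ^ 2 * β / s ≤ 2 ^ (d + 1) * ((d : ℝ) + 2) * N * (d : ℝ) ^ 2 / β := by
    rw [div_le_div_iff₀ hs0 hβ0]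
    have hc : 0 ≤ 2 ^ (d + 1) * ((d : ℝ) + 2) * N * (d : ℝ) ^ 2 * β := by positivity
    have := mul_le_mul_of_nonneg_left hs hc
    have e : β ^ 2 = β * β := sq β
    nlinarith
  have jy : (d : ℝ) / s + d * 2 ^ (d - 1) * (s / n) ≤ (d : ℝ) / β ^ 2 + 3 * d * 2 ^ (d - 1) * (β ^ bL d / β) := by
    have : (d : ℝ) * 2 ^ (d - 1) * (s / n) ≤ d * 2 ^ (d - 1) * (3 * (β ^ bL d / β)) := by gcongr
    linarith
  have p1 := mul_le_mul_of_nonneg_right jy hK0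
  have p2 := mul_le_mul_of_nonneg_right (add_le_add p1 j3) hL0
  have eJ : JD d N β = (((d : ℝ) / β ^ 2 + 3 * d * 2 ^ (d - 1) * (β ^ bL d / β)) * (Kc d N + d * (N : ℝ) ^ 2 / 2) +
      ((d : ℝ) + 1) * (N : ℝ) ^ 2 * (1 / β ^ 2)) * Real.log β + 2 ^ (d + 1) * ((d : ℝ) + 2) * N * (d : ℝ) ^ 2 / β := by
    unfold JD; ring
  rw [eJ]
  exact add_le_add p2 j4

/-- **Regime D (`n > β³`)**: descend (Lemma 17.5) to the special side length `n'' = ⌈β²⌉(m-1)+1`,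
losing `J_D(β)`. [cite: arXiv160201222, Lemma 17.7 (proof)] -/
theorem lowD (hN : 1 ≤ N) (hd : 1 ≤ d) {β : ℝ} (hβ2 : 2 ≤ β) (hr2 : β ^ (-(2 / 5 : ℝ)) ≤ 1 / 2)
    (hN10 : (N : ℝ) ≤ β ^ (1 / 10 : ℝ)) (hRb : Rbfun d (bL d) β / β ^ (1 / 10 : ℝ) ≤ 1 / N)
    (hb4 : 4 ≤ β ^ bL d) (h4 : 4 ≤ β ^ (1 - bL d)) {A₁ : ℝ} {n : ℕ} (hn3 : β ^ 3 < n)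
    (hGge : ∀ n' : ℕ, β ≤ n' → A₁ ≤ G d N n') :
    A₁ - e0 d N β - errLB d N β - JD d N β ≤ T d N n β := by
  have hβ0 : 0 < β := by linarith
  have hβ1 : 1 ≤ β := by linarith
  obtain ⟨hmb, hmb'⟩ := floor_scale (Real.rpow_nonneg hβ0.le (bL d))
  obtain ⟨hρ1, hsge, hsle, h3cube⟩ := nD_size (d := d) hβ2 hb4 h4
  set m := ⌊β ^ bL d⌋₊ with hm
  set ρ : ℕ := ⌈β ^ 2⌉₊ with hρ
  set n'' := fineN m ρ with hn''
  have hm3r : (3 : ℝ) ≤ m := by linarith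
  have hm3 : 3 ≤ m := by exact_mod_cast hm3r
  have hn''1 : 1 ≤ n'' := by rw [hn'', fineN]; omega
  have hsn : n'' + 1 ≤ n := by
    have : (n'' : ℝ) + 1 < n := by linarith
    exact_mod_cast this.le
  have hn''3 : (n'' : ℝ) ≤ 3 * β ^ 3 := by nlinarith [show (0:ℝ) ≤ β ^ 3 by positivity]
  have hB := lowB (d := d) hN hd hβ2 hr2 hN10 hRb hb4 hmb hmb' hρ1 hn''3
  have hdesc := T_sub_le_T_of_ge (d := d) (N := N) hβ2 hd hn''1 hsn
  have hjunk := descent_junk_le_JD (d := d) (N := N) hβ2 hsge hsle hn3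
  have hβn'' : β ≤ n'' := by nlinarith
  have hG := hGge n'' hβn''
  linarith


/-! ### Lemma 17.7: the lower bound for the joint limit -/

/-- **Lemma 17.7 (the lower bound, joint in `n` and `β`)**: if `G(n) → A` then for every `ε > 0`,
eventually as `(n, β) → (∞, ∞)`, `T(B_n, β) ≥ A - ε`; by the three regimes `n ≤ β^c` (`lowA`),
`β^c < n ≤ β³` (`lowC`) and `n > β³` (`lowD`). [cite: arXiv160201222, Lemma 17.7] -/
theorem eventually_le_T (hd : 2 ≤ d) (hN : 1 ≤ N) {A : ℝ} (hG : Tendsto (G d N) atTop (𝓝 A))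
    {ε : ℝ} (hε : 0 < ε) :
    ∀ᶠ p : ℕ × ℝ in atTop ×ˢ atTop, A - ε ≤ T d N p.1 p.2 := by
  have hd1 : 1 ≤ d := by omega
  have hN0 : (0 : ℝ) < N := by exact_mod_cast hN
  -- Step 1: threshold in `n`
  have hev_m : ∀ᶠ m : ℕ in atTop, A - ε / 8 ≤ G d N m ∧ (N : ℝ) ^ 2 * (Real.log 2 / (m : ℝ) ^ d) ≤ ε / 8 := by
    have h1 : ∀ᶠ m : ℕ in atTop, A - ε / 8 ≤ G d N m :=
      hG.eventually (le_mem_nhds (by linarith : A - ε / 8 < A))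
    have h2 : Tendsto (fun m : ℕ => (N : ℝ) ^ 2 * (Real.log 2 / (m : ℝ) ^ d)) atTop (𝓝 0) := by
      have := ((tendsto_const_nhds (x := Real.log 2)).div_atTop
        ((tendsto_pow_atTop (n := d) (by omega)).comp tendsto_natCast_atTop_atTop)).const_mul ((N : ℝ) ^ 2)
      simpa using this
    exact h1.and (h2.eventually (ge_mem_nhds (by positivity)))
  obtain ⟨M₀, hM₀⟩ := eventually_atTop.1 hev_m
  set M := max M₀ 1 with hM
  have hMspec : ∀ m, M ≤ m → A - ε / 8 ≤ G d N m ∧ (N : ℝ) ^ 2 * (Real.log 2 / (m : ℝ) ^ d) ≤ ε / 8 :=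
    fun m hm => hM₀ m ((le_max_left _ _).trans hm)
  have hM1 : 1 ≤ M := le_max_right _ _
  -- Step 2: thresholds in `β`
  have hK3lim : Tendsto (fun β : ℝ => K₃ d N * (β ^ bL d / β ^ cL d * Real.log β)) atTop (𝓝 0) := by
    have h := (tendsto_rpow_mul_log (p := bL d - cL d) (by linarith [bL_lt_cL (d := d)])).const_mul (K₃ d N)
    rw [mul_zero] at h
    refine h.congr' ?_
    filter_upwards [eventually_gt_atTop 0] with β hβ
    rw [Real.rpow_sub hβ]
  have hev_β : ∀ᶠ β : ℝ in atTop, 2 ≤ β ∧ β ^ (-(2 / 5 : ℝ)) ≤ 1 / 2 ∧ e0 d N β ≤ ε / 8 ∧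
      (N : ℝ) ≤ β ^ (1 / 10 : ℝ) ∧ Wfun d (cL d) β / β ^ (1 / 5 : ℝ) ≤ 1 / (N : ℝ) ^ 2 ∧
      Rbfun d (bL d) β / β ^ (1 / 10 : ℝ) ≤ 1 / N ∧ 4 ≤ β ^ bL d ∧ errLB d N β ≤ ε / 8 ∧
      K₃ d N * (β ^ bL d / β ^ cL d * Real.log β) ≤ ε / 8 ∧ (M : ℝ) ≤ β ∧ 4 ≤ β ^ (1 - bL d) ∧
      JD d N β ≤ ε / 8 := by
    refine (eventually_ge_atTop 2).and (Eventually.and ?_ (Eventually.and ?_ (Eventually.and ?_ (Eventually.and ?_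
      (Eventually.and ?_ (Eventually.and ?_ (Eventually.and ?_ (Eventually.and ?_ (Eventually.and ?_ (Eventually.and ?_ ?_))))))))))
    · exact (tendsto_rpow_neg_atTop (by norm_num : (0 : ℝ) < 2 / 5)).eventually (ge_mem_nhds (by norm_num))
    · exact (tendsto_e0 (d := d) (N := N)).eventually (ge_mem_nhds (by positivity))
    · exact (tendsto_rpow_atTop (by norm_num : (0 : ℝ) < 1 / 10)).eventually_ge_atTop _
    · exact (tendsto_Wfun_div (d := d) cL_mul_lt).eventually (ge_mem_nhds (by positivity))
    · exact (tendsto_Rbfun_div (d := d) hd1 bL_pos.le bL_mul_lt).eventually (ge_mem_nhds (by positivity))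
    · exact (tendsto_rpow_atTop (bL_pos (d := d))).eventually_ge_atTop _
    · exact (tendsto_errLB (d := d) (N := N)).eventually (ge_mem_nhds (by positivity))
    · exact hK3lim.eventually (ge_mem_nhds (by positivity))
    · exact eventually_ge_atTop _
    · exact (tendsto_rpow_atTop (by linarith [bL_lt_one (d := d)] : (0 : ℝ) < 1 - bL d)).eventually_ge_atTop _
    · exact (tendsto_JD (d := d) (N := N)).eventually (ge_mem_nhds (by positivity))
  -- Step 3: the pointwise argument
  refine ((eventually_ge_atTop M).prod_mk hev_β).mono ?_
  rintro ⟨n, β⟩ ⟨hn, c1, c2, c3, c4, c5, c6, c7, c8, c9, c10, c11, c12⟩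
  dsimp only at hn c1 c2 c3 c4 c5 c6 c7 c8 c9 c10 c11 c12 ⊢
  have hn1 : 1 ≤ n := hM1.trans hn
  by_cases hA : (n : ℝ) ≤ β ^ cL d
  · have h := lowA (d := d) hN hd1 c1 c2 c5 hn1 hA
    obtain ⟨hGn, hlogn⟩ := hMspec n hn
    linarith
  · push Not at hA
    by_cases hC : (n : ℝ) ≤ β ^ 3
    · have h := lowC (d := d) hN hd1 c1 c2 c4 c6 c7 (A₁ := A - ε / 8) hA hC
        (fun n' hnn' => (hMspec n' (hn.trans hnn')).1)
      linarith
    · push Not at hC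
      have h := lowD (d := d) hN hd1 c1 c2 c4 c6 c7 c11 (A₁ := A - ε / 8) hC
        (fun n' hβn' => (hMspec n' (by
          have : (M : ℝ) ≤ n' := c10.trans hβn'
          exact_mod_cast this)).1)
      linarith

/-- **The joint limit of the normalised free energy** (Lemmas 17.4 and 17.7): if `G(n) → A` then
`T(B_n, β) → A` as `n → ∞` and `β → ∞` jointly. [cite: arXiv160201222, §17 (proof of Thm. 2.1)] -/
theorem tendsto_T (hd : 2 ≤ d) (hN : 1 ≤ N) {A : ℝ} (hG : Tendsto (G d N) atTop (𝓝 A)) :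
    Tendsto (fun p : ℕ × ℝ => T d N p.1 p.2) (atTop ×ˢ atTop) (𝓝 A) := by
  rw [Metric.tendsto_nhds]
  intro ε hε
  filter_upwards [eventually_T_le (N := N) hd hG (half_pos hε), eventually_le_T hd hN hG (half_pos hε)]
    with p h1 h2
  rw [Real.dist_eq, abs_lt]
  constructor <;> linarith

/-- `|E_n^1|/n^d → d - 1`. [cite: arXiv160201222, Lemma 17.1] -/
theorem tendsto_coef (hd : 1 ≤ d) : Tendsto (coef d) atTop (𝓝 ((d : ℝ) - 1)) := by
  have h1 : Tendsto (fun n : ℕ => (d : ℝ) / n) atTop (𝓝 0) :=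
    tendsto_const_nhds.div_atTop tendsto_natCast_atTop_atTop
  have h2 : Tendsto (fun n : ℕ => 1 / (n : ℝ) ^ d) atTop (𝓝 0) :=
    tendsto_const_nhds.div_atTop ((tendsto_pow_atTop (by omega)).comp tendsto_natCast_atTop_atTop)
  have h := ((tendsto_const_nhds (x := (d : ℝ) - 1)).sub h1).add h2
  simp only [sub_zero, add_zero] at h
  refine h.congr' ?_
  filter_upwards [eventually_ge_atTop 1] with n hn
  rw [coef_eq hd hn]

/-- **The main term**: if `log Z_M(B_n)/n^d → L` (Theorem 15.2) then
`G(n) → (d-1) log c_H + N² L`. [cite: arXiv160201222, §17 (proof of Thm. 2.1)] -/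
theorem tendsto_G (hd : 1 ≤ d) {L : ℝ} (hL : Tendsto (fun n : ℕ => logZM d n / (n : ℝ) ^ d) atTop (𝓝 L)) :
    Tendsto (G d N) atTop (𝓝 (((d : ℝ) - 1) * Real.log ((haarChartConst N : ℝ≥0) : ℝ) + (N : ℝ) ^ 2 * L)) :=
  ((tendsto_coef hd).mul_const _).add (hL.const_mul _)

/-- **Chatterjee's Theorem 2.1 for `U(N)` with the soft Haar constant, modulo Theorem 15.2**: if
the axial-gauge lattice Maxwell free energy per site converges, `log Z_M(B_n)/n^d → L`, then for
`d ≥ 2`, `N ≥ 1`, jointly as `n → ∞` and `β → ∞`,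
`F(B_n, β) + ½(d - 1 - d/n + 1/n^d) N² log β → (d-1) log c_H + N² L`,
where `c_H = haarChartConst N` (whose value `∏_{j<N} j!/(2π)^{N(N+1)/2}` is Theorem 6.1, file
`UnitaryHaarVolume`). [cite: arXiv160201222, Thm. 2.1, §17] -/
theorem tendsto_freeEnergyPerSite_of_tendsto_logZM (hd : 2 ≤ d) (hN : 1 ≤ N) {L : ℝ}
    (hL : Tendsto (fun n : ℕ => logZM d n / (n : ℝ) ^ d) atTop (𝓝 L)) :
    Tendsto
      (fun p : ℕ × ℝ =>
        freeEnergyPerSite (unitaryFundamentalRep (Fin N) ℂ) p.2 (halfOpenBox d p.1) +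
          (1 / 2) * ((d : ℝ) - 1 - d / p.1 + 1 / (p.1 : ℝ) ^ d) * (N : ℝ) ^ 2 * Real.log p.2)
      (atTop ×ˢ atTop)
      (𝓝 (((d : ℝ) - 1) * Real.log ((haarChartConst N : ℝ≥0) : ℝ) + (N : ℝ) ^ 2 * L)) := by
  have hd1 : 1 ≤ d := by omega
  have h := tendsto_T hd hN (tendsto_G (N := N) hd1 hL)
  refine h.congr' ?_
  have hev : ∀ᶠ p : ℕ × ℝ in atTop ×ˢ atTop, 1 ≤ p.1 := (eventually_ge_atTop 1).prod_inl _
  filter_upwards [hev] with p hp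
  show T d N p.1 p.2 = _
  rw [T, F, coef_eq hd1 hp]
  ring

end ChatterjeeJointLimit

end Literature.MathematicalPhysics.QuantumFieldTheory
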